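import Literature.Computability.Cryptography.SISFunctionProofs
import Literature.Computability.Complexity.StackRoutines
import Literature.Computability.Complexity.EncodingFrames
import HarnessLib

/-!
# Ajtai's SIS function is polynomial-time computable (discharge of `sisFunction_polyTimeComputable`)

Sibling proof file (D-0014 provefact) of `Literature/Computability/Cryptography/SISFunction.lean`,
continuing `SISFunctionProofs.lean` (which discharged the parameter fact
`sisParams_isPolyTimeParams`). The named fact `Literature.PQC.sisFunction_polyTimeComputable =
PolyTimeComputable id id SIS.sisFunction` — one of the TM2-level leaves of
`Literature.Computability.Cryptography.owfExist_of_gapSVP_worstCaseHard` (`LatticeOWFProofs.lean`) — is PROVED here: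

* `Literature.PQC.sisFunction_polyTimeComputable_holds : sisFunction_polyTimeComputable`.

Recall (`SISFunction.lean`): on `w ∈ {0,1}^k`, with `n = dimOf k` (the largest `n` with
`keyLen n ≤ k`), `t = bitWidth n = 16 ⌊log₂(2n+4)⌋`, `m = width n = 2 n t`, `q = 2^t`,
`sisFunction w = boolPair (encodeMatrix A) (boolPair (encodeResidues (A x mod q)) pad)` where
`A ∈ ℤ_q^{n×m}` is read from the first `n m t` bits (`t` bits per entry, row-major, LSB first),
`x ∈ {0,1}^m` from the next `m` bits, and `pad` is the rest.

## The specification as a flat string (`sisFunctionWith_eq`)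

`boolPair`, `Encoding.listBool`, `encodingFinVec` are unfolded into `repBits 2` (bit doubling),
the separator `01` and `frames` (`boolPair_eq`, `listBool_encode_eq`, `finVec_encode_eq`), so
that `sisFunctionWith n m t w` is the concatenation
`repBits 2 (matrixCode n m t w) ++ 01 ++ repBits 2 (residueCode n m t w) ++ 01 ++ pad`
(`sisFunctionWith_eq`), with the entries `entryVal` (chunk values, `parseMatrix_apply_val`) and the
residues `residueVal` (selected sums modulo `2^t`, `hashFun_parse_val`) as plain arithmetic.

## The machine (`sisProg`)

A structured stack program over `AReg ⊕ Q` — the arithmetic bank of `StackArith.lean` plus 21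
program registers (`Q`; register contents as a record `QF`, so that simulation lemmas mention
only the registers that change) — using the generic routines of `StackRoutines.lean`:

* Phase A (`phaseA`, `runs_phaseA`): `n = dimOf k` by trying all candidates `c = 1, …, k`
  (`candStep`: `c` in unary and binary, `L = size (c+2)` as the length of a normalised numeral,
  `m = 32 c L` and `keyLen c = c m t + m` by iterated addition (`wreg`, `kreg`,
  `bitsToNat_kreg`), comparison with `k` by the bank's subtraction-with-borrow, one `true` on
  `nU` per hit; `cnt_self`: the hits are exactly `dimOf k`, by `keyLen_strictMono`);
* Phase B (`phaseB1`, `phaseB2`): `t`, `m` in unary (`tU`, `mU`), `m` in binary (`wbin`);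
* Phase C (`phaseC1`, `phaseC2`): the `n m t` matrix bits (`n · m` chunks read by nested counted
  loops into the bank's `s`, then poured back in order into `hb`), the `m` bits of `x` (`xv`);
* Phase D (`phaseD`): the headers `quad (encodeNat n) 0011 quad (encodeNat m) 0011
  quad (encodeNat q) 0011 quad (1^n) 0011` of the (doubled) matrix code and `quad (1^n) 0011` of
  the (doubled) residue code, on the output buffers `o1`, `o2` (which hold the reverse of the
  emitted strings);
* Phase E (`phaseE`, rows by `rowStep`, entries by `entryStep`): per entry read a `t`-bit chunk,
  normalise it (`encodeNat` of its value), emit it at doubling level 8 with its separator, and add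
  it to the accumulator iff the corresponding bit of `x` is set; per row truncate the accumulator
  to `t` bits (`= mod 2^t`, `bitsToNat_take_mod`), normalise and emit it at level 4 on `o2`
  (functional models `accL`, `entsOut`, `rowCode`, `resCode`, `rowsOut`, `ressOut`);
* Phase F (`phaseF`): close both buffers with `01`, move the padding to `out`, pour the buffers
  on top.

`runs_sisProg`: the machine ends with `out = outStr n t m w` within `totalCost` steps;
`outStr_eq`: `outStr n t m w = sisFunctionWith n m t w` (`E1_eq`, `E2_eq`: the emitted strings
are the doubled codes — `frames_ofFn`, `repBits_frame`, `chk_eq_chunk`, `bitsToNat_accL`,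
`resCode_eq`); `totalCost_le`: `totalCost ≤ sisBudget(k)` with
`sisBudget = budgetA + 2000 (32 (X+2)² + 4)³` (all lengths bounded via `B = 32 (k+2)²`,
`params_le`); and `Com.mem_FP` compiles the whole to `TM2`.

## Relocations owed

Two one-line lemmas are, up to their names, twins of lemmas in foreign import closures and are
named apart until all copies move to `Complexity/BoolEncodings.lean`: `unary_eq_replicate_true`
(= `Literature.Computability.Complexity.unaryEncodeNat_eq_replicate`, `Complexity/TautCertificates.lean`, closure
`CNF`) and `encodeNat_length_le_self` (= `Literature.Computability.MetaComplexity.length_encodeNat_le`,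
`MetaComplexity/FregeProofs.lean`, closure `CNF`/`Frege`/`ProofSystems`). The generic framing lemmas
(`boolPair_eq`, `frames`, `listBool_encode_eq`, `finVec_encode_eq`, `ccat`, `sep`, …) now live in
`Complexity/EncodingFrames.lean`.

## References

* M. Ajtai, *Generating hard instances of lattice problems*, STOC 1996, Thm. 1 (the function
  `x ↦ A x mod q` is easy to compute).
* D. Micciancio, O. Regev, *Worst-case to average-case reductions based on Gaussian measures*,
  SIAM J. Comput. 37 (2007), §5.1.
* S. Arora, B. Barak, *Computational Complexity: A Modern Approach*, CUP 2009, §1.3 (polynomial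
  time; robustness of the model), §0.1 (representations).
* T. Nipkow, G. Klein, *Concrete Semantics*, Springer 2014, Ch. 7 (reasoning with big-step
  semantics).
-/

noncomputable section

namespace Literature.Computability.Cryptography.SISMachine

open _root_.Computability Complexity Complexity.Com
open SIS (width bitWidth logLen keyLen dimOf parseMatrix parseVec hashFun modVec encodeMatrix encodeResidues sisFunctionWith sisFunction le_dimOf keyLen_dimOf_le le_keyLen keyLen_strictMono encodeNat_two_pow_eq_replicate size_add_two)

/-! ### Repeated bits and the framing of the encodings -/

/-! ### The pieces of `sisFunctionWith` -/

/-- The `(i, j)` chunk of `t` bits. [folklore] -/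
def chunk (m t : ℕ) (w : List Bool) (i j : ℕ) : List Bool := (w.drop ((i * m + j) * t)).take t

/-- The value of an entry. [folklore] -/
def entryVal (m t : ℕ) (w : List Bool) (i j : ℕ) : ℕ := Complexity.bitsToNat (chunk m t w i j)

/-- Entries are `t`-bit numbers. [folklore] -/
theorem entryVal_lt (m t : ℕ) (w : List Bool) (i j : ℕ) : entryVal m t w i j < 2 ^ t := by
  unfold entryVal chunk
  refine (bitsToNat_lt _).trans_le (Nat.pow_le_pow_right (by norm_num) ?_)
  simp

/-- Bridge: `SIS.bitsToNat` (the `Nat.ofDigits` form of `SISFunction.lean`) is the canonical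
`Literature.Computability.Complexity.bitsToNat`. (Also in `SISFunctionSolver.lean` as `SIS.bitsToNat_eq`; restated to
keep this file's imports to `SISFunction` + `StackArith`.) [folklore] -/
theorem bitsToNat_eq_cplx (l : List Bool) : SIS.bitsToNat l = Complexity.bitsToNat l := by
  induction l with
  | nil => rfl
  | cons b l ih =>
    rw [Complexity.bitsToNat_cons, ← ih]
    cases b <;> simp [SIS.bitsToNat, Nat.ofDigits_cons]

/-- The parsed matrix entry is the chunk value. [folklore] -/
theorem parseMatrix_apply_val (n m t : ℕ) (w : List Bool) (i : Fin n) (j : Fin m) :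
    (parseMatrix n m t w i j).val = entryVal m t w i j := by
  rw [parseMatrix, Matrix.of_apply, bitsToNat_eq_cplx, ZMod.val_natCast]
  exact Nat.mod_eq_of_lt (entryVal_lt m t w i j)

/-- The `j`-th input bit of `x`. [folklore] -/
def xBit (n m t : ℕ) (w : List Bool) (j : ℕ) : Bool := w.getD (n * m * t + j) false

/-- The `i`-th residue: the sum of the selected entries of row `i` modulo `2^t`. [folklore] -/
def residueVal (n m t : ℕ) (w : List Bool) (i : ℕ) : ℕ :=
  (∑ j : Fin m, if xBit n m t w j then entryVal m t w i j else 0) % 2 ^ t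

/-- The hash value's representative is `residueVal`. [folklore] -/
theorem hashFun_parse_val (n m t : ℕ) (w : List Bool) (i : Fin n) :
    (hashFun (parseMatrix n m t w) (parseVec (n * m * t) m w) i).val = residueVal n m t w i := by
  haveI : NeZero (2 ^ t) := ⟨pow_ne_zero _ two_ne_zero⟩
  rw [hashFun, Matrix.mulVec, dotProduct]
  have : ∀ j : Fin m, parseMatrix n m t w i j * modVec (2 ^ t) (parseVec (n * m * t) m w) j =
      ((if xBit n m t w j then entryVal m t w i j else 0 : ℕ) : ZMod (2 ^ t)) := by
    intro j
    have hv : (parseMatrix n m t w i j) = ((entryVal m t w i j : ℕ) : ZMod (2 ^ t)) := by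
      rw [← parseMatrix_apply_val n m t w i j, ZMod.natCast_zmod_val]
    unfold modVec parseVec xBit
    split_ifs <;> simp [hv]
  rw [Finset.sum_congr rfl fun j _ => this j, ← Nat.cast_sum, ZMod.val_natCast, residueVal]

/-- The codes of the entries of row `i`. [folklore] -/
def entryCodes (m t : ℕ) (w : List Bool) (i : ℕ) : ℕ → List Bool := fun j => encodeNat (entryVal m t w i j)

/-- The code of row `i` (before the outer framing). [folklore] -/
def rowCodeS (m t : ℕ) (w : List Bool) : ℕ → List Bool := fun i =>
  repBits 2 (unaryEncodeNat m) ++ [false, true] ++ frames (List.ofFn fun j : Fin m => entryCodes m t w i j)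

/-- The matrix code. [folklore] -/
def matrixCode (n m t : ℕ) (w : List Bool) : List Bool :=
  repBits 2 (encodeNat n) ++ [false, true] ++ (repBits 2 (encodeNat m) ++ [false, true] ++
    (repBits 2 (encodeNat (2 ^ t)) ++ [false, true] ++
      (repBits 2 (unaryEncodeNat n) ++ [false, true] ++ frames (List.ofFn fun i : Fin n => rowCodeS m t w i))))

/-- The codes of the residues. [folklore] -/
def resCodeS (n m t : ℕ) (w : List Bool) : ℕ → List Bool := fun i => encodeNat (residueVal n m t w i)

/-- The residue code. [folklore] -/
def residueCode (n m t : ℕ) (w : List Bool) : List Bool :=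
  repBits 2 (unaryEncodeNat n) ++ [false, true] ++ frames (List.ofFn fun i : Fin n => resCodeS n m t w i)

/-- Unfolding `encodeMatrix` into doubling, separators and frames. [folklore] -/
theorem encodeMatrix_eq {n m q : ℕ} (A : Matrix (Fin n) (Fin m) (ZMod q)) :
    encodeMatrix A =
      repBits 2 (encodeNat n) ++ [false, true] ++ (repBits 2 (encodeNat m) ++ [false, true] ++
        (repBits 2 (encodeNat q) ++ [false, true] ++
          (repBits 2 (unaryEncodeNat n) ++ [false, true] ++
            frames (List.ofFn fun i : Fin n =>
              repBits 2 (unaryEncodeNat m) ++ [false, true] ++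
                frames (List.ofFn fun j : Fin m => encodeNat (A i j).val))))) := by
  have he : (encodingNatBool.encode : ℕ → List Bool) = encodeNat := rfl
  simp only [encodeMatrix, boolPair_eq, finVec_encode_eq, he]

/-- The matrix code of the parsed matrix is `matrixCode`. [folklore] -/
theorem encodeMatrix_parseMatrix (n m t : ℕ) (w : List Bool) :
    encodeMatrix (parseMatrix n m t w) = matrixCode n m t w := by
  rw [encodeMatrix_eq, matrixCode]
  simp only [rowCodeS, entryCodes, parseMatrix_apply_val]

/-- The residue code of the hash value is `residueCode`. [folklore] -/
theorem encodeResidues_hashFun (n m t : ℕ) (w : List Bool) :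
    encodeResidues (hashFun (parseMatrix n m t w) (parseVec (n * m * t) m w)) =
      residueCode n m t w := by
  have he : (encodingNatBool.encode : ℕ → List Bool) = encodeNat := rfl
  rw [encodeResidues, finVec_encode_eq, residueCode]
  simp only [resCodeS, he, hashFun_parse_val]

/-- **`sisFunctionWith` as a flat string.** [folklore] -/
theorem sisFunctionWith_eq (n m t : ℕ) (w : List Bool) :
    sisFunctionWith n m t w =
      repBits 2 (matrixCode n m t w) ++ [false, true] ++
        (repBits 2 (residueCode n m t w) ++ [false, true] ++ w.drop (n * m * t + m)) := by
  rw [sisFunctionWith, boolPair_eq, boolPair_eq, encodeMatrix_parseMatrix, encodeResidues_hashFun]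

end Literature.Computability.Cryptography.SISMachine


/-! ## The SIS-function machine -/

namespace Literature.Computability.Cryptography.SISMachine

open _root_.Computability Polynomial Complexity Complexity.Com Complexity.AReg
open SIS (width bitWidth logLen keyLen dimOf parseMatrix parseVec hashFun modVec encodeMatrix encodeResidues sisFunctionWith sisFunction le_dimOf keyLen_dimOf_le le_keyLen keyLen_strictMono encodeNat_two_pow_eq_replicate size_add_two)

/-! ### The program registers -/

/-- The program registers of the SIS-function machine (next to the arithmetic bank `AReg`):
input, output, the two output buffers, loop fuel, matrix bits, the vector `x` and its per-row
copy, unary/binary counters for `n`, `c`, `k`, `t`, `m`, `L`, the accumulator and binary `m`.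
[folklore] -/
inductive Q where
  | inp | out | o1 | o2 | fuel | hb | xv | xc | nU | nC | cU | cC | cb | kb | tU | tC | mU | mC | lb | acc | mb
  deriving DecidableEq, Fintype, Repr

/-- The register type of the SIS-function machine. [folklore] -/
abbrev QR : Type := AReg ⊕ Q

/-- Contents of the program registers, as a record (so that simulation lemmas mention only the
registers that change, via record update). [folklore] -/
structure QF where
  /-- register `inp` -/
  inp : List Bool := []
  /-- register `out` -/
  out : List Bool := []
  /-- register `o1` -/
  o1 : List Bool := []
  /-- register `o2` -/
  o2 : List Bool := []
  /-- register `fuel` -/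
  fuel : List Bool := []
  /-- register `hb` -/
  hb : List Bool := []
  /-- register `xv` -/
  xv : List Bool := []
  /-- register `xc` -/
  xc : List Bool := []
  /-- register `nU` -/
  nU : List Bool := []
  /-- register `nC` -/
  nC : List Bool := []
  /-- register `cU` -/
  cU : List Bool := []
  /-- register `cC` -/
  cC : List Bool := []
  /-- register `cb` -/
  cb : List Bool := []
  /-- register `kb` -/
  kb : List Bool := []
  /-- register `tU` -/
  tU : List Bool := []
  /-- register `tC` -/
  tC : List Bool := []
  /-- register `mU` -/
  mU : List Bool := []
  /-- register `mC` -/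
  mC : List Bool := []
  /-- register `lb` -/
  lb : List Bool := []
  /-- register `acc` -/
  acc : List Bool := []
  /-- register `mb` -/
  mb : List Bool := []

namespace QF

/-- A record of register contents as a register file. [folklore] -/
def get (F : QF) : Regs Q
  | .inp => F.inp
  | .out => F.out
  | .o1 => F.o1
  | .o2 => F.o2
  | .fuel => F.fuel
  | .hb => F.hb
  | .xv => F.xv
  | .xc => F.xc
  | .nU => F.nU
  | .nC => F.nC
  | .cU => F.cU
  | .cC => F.cC
  | .cb => F.cb
  | .kb => F.kb
  | .tU => F.tU
  | .tC => F.tC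
  | .mU => F.mU
  | .mC => F.mC
  | .lb => F.lb
  | .acc => F.acc
  | .mb => F.mb

section Lemmas

variable (F : QF) (v : List Bool)
/-- Reading `inp`. [folklore] -/ @[simp] theorem get_inp : F.get .inp = F.inp := rfl
/-- Reading `out`. [folklore] -/ @[simp] theorem get_out : F.get .out = F.out := rfl
/-- Reading `o1`. [folklore] -/ @[simp] theorem get_o1 : F.get .o1 = F.o1 := rfl
/-- Reading `o2`. [folklore] -/ @[simp] theorem get_o2 : F.get .o2 = F.o2 := rfl
/-- Reading `fuel`. [folklore] -/ @[simp] theorem get_fuel : F.get .fuel = F.fuel := rfl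
/-- Reading `hb`. [folklore] -/ @[simp] theorem get_hb : F.get .hb = F.hb := rfl
/-- Reading `xv`. [folklore] -/ @[simp] theorem get_xv : F.get .xv = F.xv := rfl
/-- Reading `xc`. [folklore] -/ @[simp] theorem get_xc : F.get .xc = F.xc := rfl
/-- Reading `nU`. [folklore] -/ @[simp] theorem get_nU : F.get .nU = F.nU := rfl
/-- Reading `nC`. [folklore] -/ @[simp] theorem get_nC : F.get .nC = F.nC := rfl
/-- Reading `cU`. [folklore] -/ @[simp] theorem get_cU : F.get .cU = F.cU := rfl
/-- Reading `cC`. [folklore] -/ @[simp] theorem get_cC : F.get .cC = F.cC := rfl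
/-- Reading `cb`. [folklore] -/ @[simp] theorem get_cb : F.get .cb = F.cb := rfl
/-- Reading `kb`. [folklore] -/ @[simp] theorem get_kb : F.get .kb = F.kb := rfl
/-- Reading `tU`. [folklore] -/ @[simp] theorem get_tU : F.get .tU = F.tU := rfl
/-- Reading `tC`. [folklore] -/ @[simp] theorem get_tC : F.get .tC = F.tC := rfl
/-- Reading `mU`. [folklore] -/ @[simp] theorem get_mU : F.get .mU = F.mU := rfl
/-- Reading `mC`. [folklore] -/ @[simp] theorem get_mC : F.get .mC = F.mC := rfl
/-- Reading `lb`. [folklore] -/ @[simp] theorem get_lb : F.get .lb = F.lb := rfl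
/-- Reading `acc`. [folklore] -/ @[simp] theorem get_acc : F.get .acc = F.acc := rfl
/-- Reading `mb`. [folklore] -/ @[simp] theorem get_mb : F.get .mb = F.mb := rfl
/-- Writing `inp`. [folklore] -/
@[simp] theorem update_inp : Function.update F.get .inp v = {F with inp := v}.get := by
  funext r; cases r <;> rfl
/-- Writing `out`. [folklore] -/
@[simp] theorem update_out : Function.update F.get .out v = {F with out := v}.get := by
  funext r; cases r <;> rfl
/-- Writing `o1`. [folklore] -/
@[simp] theorem update_o1 : Function.update F.get .o1 v = {F with o1 := v}.get := by
  funext r; cases r <;> rfl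
/-- Writing `o2`. [folklore] -/
@[simp] theorem update_o2 : Function.update F.get .o2 v = {F with o2 := v}.get := by
  funext r; cases r <;> rfl
/-- Writing `fuel`. [folklore] -/
@[simp] theorem update_fuel : Function.update F.get .fuel v = {F with fuel := v}.get := by
  funext r; cases r <;> rfl
/-- Writing `hb`. [folklore] -/
@[simp] theorem update_hb : Function.update F.get .hb v = {F with hb := v}.get := by
  funext r; cases r <;> rfl
/-- Writing `xv`. [folklore] -/
@[simp] theorem update_xv : Function.update F.get .xv v = {F with xv := v}.get := by
  funext r; cases r <;> rfl
/-- Writing `xc`. [folklore] -/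
@[simp] theorem update_xc : Function.update F.get .xc v = {F with xc := v}.get := by
  funext r; cases r <;> rfl
/-- Writing `nU`. [folklore] -/
@[simp] theorem update_nU : Function.update F.get .nU v = {F with nU := v}.get := by
  funext r; cases r <;> rfl
/-- Writing `nC`. [folklore] -/
@[simp] theorem update_nC : Function.update F.get .nC v = {F with nC := v}.get := by
  funext r; cases r <;> rfl
/-- Writing `cU`. [folklore] -/
@[simp] theorem update_cU : Function.update F.get .cU v = {F with cU := v}.get := by
  funext r; cases r <;> rfl
/-- Writing `cC`. [folklore] -/
@[simp] theorem update_cC : Function.update F.get .cC v = {F with cC := v}.get := by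
  funext r; cases r <;> rfl
/-- Writing `cb`. [folklore] -/
@[simp] theorem update_cb : Function.update F.get .cb v = {F with cb := v}.get := by
  funext r; cases r <;> rfl
/-- Writing `kb`. [folklore] -/
@[simp] theorem update_kb : Function.update F.get .kb v = {F with kb := v}.get := by
  funext r; cases r <;> rfl
/-- Writing `tU`. [folklore] -/
@[simp] theorem update_tU : Function.update F.get .tU v = {F with tU := v}.get := by
  funext r; cases r <;> rfl
/-- Writing `tC`. [folklore] -/
@[simp] theorem update_tC : Function.update F.get .tC v = {F with tC := v}.get := by
  funext r; cases r <;> rfl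
/-- Writing `mU`. [folklore] -/
@[simp] theorem update_mU : Function.update F.get .mU v = {F with mU := v}.get := by
  funext r; cases r <;> rfl
/-- Writing `mC`. [folklore] -/
@[simp] theorem update_mC : Function.update F.get .mC v = {F with mC := v}.get := by
  funext r; cases r <;> rfl
/-- Writing `lb`. [folklore] -/
@[simp] theorem update_lb : Function.update F.get .lb v = {F with lb := v}.get := by
  funext r; cases r <;> rfl
/-- Writing `acc`. [folklore] -/
@[simp] theorem update_acc : Function.update F.get .acc v = {F with acc := v}.get := by
  funext r; cases r <;> rfl
/-- Writing `mb`. [folklore] -/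
@[simp] theorem update_mb : Function.update F.get .mb v = {F with mb := v}.get := by
  funext r; cases r <;> rfl

end Lemmas

end QF

open Q

/-- The empty bank. [folklore] -/
abbrev bank0 : Regs AReg := file [] [] [] [] [] [] [] []

/-- The initial register file: input in `inp`, everything else empty. [folklore] -/
theorem init_eq (z : List Bool) :
    Regs.init (Sum.inr Q.inp : QR) z = Sum.elim bank0 ({ inp := z } : QF).get := by
  funext r; rcases r with r | r <;> cases r <;> rfl

/-- A bank program on the full register type. [folklore] -/
abbrev bk (c : Com AReg) : Com QR := c.map Sum.inl

/-! ### Phase A0: fuel and the input length in binary -/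

/-- `n` in binary as produced by counting (not normalised): `iterAdd [true] n []`. [folklore] -/
def ubin (n : ℕ) : List Bool := iterAdd [true] n []

/-- Value of `ubin`. [folklore] -/
@[simp] theorem bitsToNat_ubin (n : ℕ) : Complexity.bitsToNat (ubin n) = n := by
  rw [ubin, bitsToNat_iterAdd]; simp

/-- Length of `ubin`. [folklore] -/
theorem length_ubin_le (n : ℕ) : (ubin n).length ≤ 1 + n :=
  length_iterAdd_le [true] n [] 1 (by simp) (by simp)

/-- `ubin (n+1)` is one increment of `ubin n`. [folklore] -/
theorem ubin_succ (n : ℕ) : ubin (n + 1) = addRes (ubin n) [true] := by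
  suffices h : ∀ (n : ℕ) (xs : List Bool), iterAdd [true] (n + 1) xs = addRes (iterAdd [true] n xs) [true] from
    h n []
  intro n
  induction n with
  | zero => intro xs; rfl
  | succ n ih => intro xs; rw [iterAdd, ih, ← iterAdd]

/-- Phase A0: copy the input to `fuel`, count it into `x` (so `x = z.length` in binary), park that in
`kb`, and restore `fuel`. [folklore] -/
def phaseA0 : Com QR :=
  copy (Sum.inr inp) (Sum.inr fuel) (Sum.inl .s) (Sum.inl .t) ;; push (Sum.inl .y) true ;;
    mulAddLoop fuel ;; move (Sum.inl .x) (Sum.inr kb) (Sum.inl .s) ;; clear (Sum.inl .y) ;;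
    copy (Sum.inr inp) (Sum.inr fuel) (Sum.inl .s) (Sum.inl .t)

/-- **Simulation of phase A0**, in `≤ 60 (z.length+2)²` steps. [folklore] -/
theorem runs_phaseA0 (z : List Bool) :
    Runs phaseA0 (Sum.elim bank0 ({ inp := z } : QF).get)
      (Sum.elim bank0 ({ inp := z, fuel := z, kb := ubin z.length } : QF).get)
      (60 * (z.length + 2) ^ 2) := by
  have h1 : Runs (copy (Sum.inr inp : QR) (Sum.inr fuel) (Sum.inl .s) (Sum.inl .t))
      (Sum.elim bank0 ({ inp := z } : QF).get)
      (Sum.elim bank0 ({ inp := z, fuel := z } : QF).get) (10 * z.length + 3) :=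
    (runs_copy (by decide) (by decide) (by decide) (by decide) (by decide) (by decide) _ rfl rfl).of_eq
      (by rw [Sum.update_elim_inr]; simp) (by simp)
  have h2 : Runs (push (Sum.inl AReg.y : QR) true)
      (Sum.elim bank0 ({ inp := z, fuel := z } : QF).get)
      (Sum.elim (file [] [true] [] [] [] [] [] []) ({ inp := z, fuel := z } : QF).get) 1 :=
    Runs.push' (by rw [Sum.update_elim_inl]; simp)
  have h3 : Runs (mulAddLoop fuel : Com QR)
      (Sum.elim (file [] [true] [] [] [] [] [] []) ({ inp := z, fuel := z } : QF).get)
      (Sum.elim (file (ubin z.length) [true] [] [] [] [] [] []) ({ inp := z, fuel := ([] : List Bool) } : QF).get)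
      ((26 * (1 + z.length) + 14) * z.length + 1) :=
    (runs_mulAddLoop fuel z [] [true] [] [] [] 1 (by simp) (by simp) _ rfl).of_eq
      (by rw [QF.update_fuel]; rfl) le_rfl
  have h4 : Runs (move (Sum.inl AReg.x : QR) (Sum.inr kb) (Sum.inl .s))
      (Sum.elim (file (ubin z.length) [true] [] [] [] [] [] []) ({ inp := z, fuel := ([] : List Bool) } : QF).get)
      (Sum.elim (file [] [true] [] [] [] [] [] []) ({ inp := z, fuel := ([] : List Bool), kb := ubin z.length } : QF).get)
      (6 * (ubin z.length).length + 2) :=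
    (runs_move (by decide) (by decide) (by decide) _ rfl).of_eq
      (by rw [Sum.update_elim_inl, Sum.update_elim_inr]; simp) (by simp)
  have h5 : Runs (clear (Sum.inl AReg.y : QR))
      (Sum.elim (file [] [true] [] [] [] [] [] []) ({ inp := z, fuel := ([] : List Bool), kb := ubin z.length } : QF).get)
      (Sum.elim bank0 ({ inp := z, fuel := ([] : List Bool), kb := ubin z.length } : QF).get) 3 :=
    (runs_clear _ _).of_eq (by rw [Sum.update_elim_inl]; simp) (by simp)
  have h6 : Runs (copy (Sum.inr inp : QR) (Sum.inr fuel) (Sum.inl .s) (Sum.inl .t))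
      (Sum.elim bank0 ({ inp := z, fuel := ([] : List Bool), kb := ubin z.length } : QF).get)
      (Sum.elim bank0 ({ inp := z, fuel := z, kb := ubin z.length } : QF).get) (10 * z.length + 3) :=
    (runs_copy (by decide) (by decide) (by decide) (by decide) (by decide) (by decide) _ rfl rfl).of_eq
      (by rw [Sum.update_elim_inr]; simp) (by simp)
  refine (h1.seq (h2.seq (h3.seq (h4.seq (h5.seq h6))))).of_eq rfl ?_
  have := length_ubin_le z.length
  nlinarith [this]


/-! ### Phase A: the dimension `n = dimOf k` by trying all candidates -/

section PhaseA
open Q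

/-- Binary size bound: `size (i+3) ≤ i + 3`. [folklore] -/
theorem size_le_self' (i : ℕ) : (i + 3).size ≤ i + 3 := Nat.size_le.2 Nat.lt_two_pow_self

/-- Candidate step, part 1: `c := c + 1` in unary (`cU`) and binary (`cb`), and
`x := encodeNat (c + 2)` (whose length is `L(c) = ⌊log₂(2c+4)⌋`). [folklore] -/
def candC1 : Com QR :=
  push (Sum.inr cU) true ;; move (Sum.inr cb) (Sum.inl .x) (Sum.inl .s) ;; push (Sum.inl .y) true ;;
    bk add ;; copy (Sum.inl .x) (Sum.inr cb) (Sum.inl .s) (Sum.inl .t) ;; bk add ;; bk add ;;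
    clear (Sum.inl .y) ;; bk normalize

/-- **Simulation of `candC1`.** [folklore] -/
theorem runs_candC1 (G : QF) (i : ℕ) (hcU : G.cU = List.replicate i true) (hcb : G.cb = ubin i) :
    Runs candC1 (Sum.elim bank0 G.get)
      (Sum.elim (file (encodeNat (i + 3)) [] [] [] [] [] [] [])
        { G with cU := List.replicate (i + 1) true, cb := ubin (i + 1) }.get)
      (100 * (i + 4)) := by
  have hlen0 := length_ubin_le i
  have hlen1 := length_ubin_le (i + 1)
  have h1 : Runs (push (Sum.inr cU : QR) true) (Sum.elim bank0 G.get)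
      (Sum.elim bank0 { G with cU := List.replicate (i + 1) true }.get) 1 :=
    Runs.push' (by rw [Sum.update_elim_inr]; simp [hcU, List.replicate_succ])
  have h2 : Runs (move (Sum.inr cb : QR) (Sum.inl .x) (Sum.inl .s))
      (Sum.elim bank0 { G with cU := List.replicate (i + 1) true }.get)
      (Sum.elim (file (ubin i) [] [] [] [] [] [] [])
        { G with cU := List.replicate (i + 1) true, cb := [] }.get) (6 * (ubin i).length + 2) :=
    (runs_move (by decide) (by decide) (by decide) _ rfl).of_eq
      (by rw [Sum.update_elim_inr, Sum.update_elim_inl]; simp [hcb]) (by simp [hcb])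
  have h3 : Runs (push (Sum.inl AReg.y : QR) true)
      (Sum.elim (file (ubin i) [] [] [] [] [] [] [])
        { G with cU := List.replicate (i + 1) true, cb := [] }.get)
      (Sum.elim (file (ubin i) [true] [] [] [] [] [] [])
        { G with cU := List.replicate (i + 1) true, cb := [] }.get) 1 :=
    Runs.push' (by rw [Sum.update_elim_inl]; simp)
  have h4 : Runs (bk add)
      (Sum.elim (file (ubin i) [true] [] [] [] [] [] [])
        { G with cU := List.replicate (i + 1) true, cb := [] }.get)
      (Sum.elim (file (ubin (i + 1)) [true] [] [] [] [] [] [])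
        { G with cU := List.replicate (i + 1) true, cb := [] }.get) (13 * ((ubin i).length + 1) + 12) :=
    ((runs_add (ubin i) [true] [] [] []).inl _).of_eq (by rw [ubin_succ]) (by simp)
  have h5 : Runs (copy (Sum.inl AReg.x : QR) (Sum.inr cb) (Sum.inl .s) (Sum.inl .t))
      (Sum.elim (file (ubin (i + 1)) [true] [] [] [] [] [] [])
        { G with cU := List.replicate (i + 1) true, cb := [] }.get)
      (Sum.elim (file (ubin (i + 1)) [true] [] [] [] [] [] [])
        { G with cU := List.replicate (i + 1) true, cb := ubin (i + 1) }.get) (10 * (ubin (i + 1)).length + 3) :=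
    (runs_copy (by decide) (by decide) (by decide) (by decide) (by decide) (by decide) _ rfl rfl).of_eq
      (by rw [Sum.update_elim_inr]; simp) (by simp)
  set x1 := addRes (ubin (i + 1)) [true] with hx1
  have hx1len : x1.length ≤ 3 + i := by
    have := length_addRes_le_max (ubin (i + 1)) [true]
    rw [← hx1] at this; simp only [List.length_singleton] at this; omega
  have h6 : Runs (bk add)
      (Sum.elim (file (ubin (i + 1)) [true] [] [] [] [] [] [])
        { G with cU := List.replicate (i + 1) true, cb := ubin (i + 1) }.get)
      (Sum.elim (file x1 [true] [] [] [] [] [] [])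
        { G with cU := List.replicate (i + 1) true, cb := ubin (i + 1) }.get) (13 * ((ubin (i + 1)).length + 1) + 12) :=
    ((runs_add (ubin (i + 1)) [true] [] [] []).inl _).of_eq rfl (by simp)
  set x2 := addRes x1 [true] with hx2
  have hx2len : x2.length ≤ 4 + i := by
    have := length_addRes_le_max x1 [true]
    rw [← hx2] at this; simp only [List.length_singleton] at this; omega
  have h7 : Runs (bk add)
      (Sum.elim (file x1 [true] [] [] [] [] [] [])
        { G with cU := List.replicate (i + 1) true, cb := ubin (i + 1) }.get)
      (Sum.elim (file x2 [true] [] [] [] [] [] [])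
        { G with cU := List.replicate (i + 1) true, cb := ubin (i + 1) }.get) (13 * (x1.length + 1) + 12) :=
    ((runs_add x1 [true] [] [] []).inl _).of_eq rfl (by simp)
  have h8 : Runs (clear (Sum.inl AReg.y : QR))
      (Sum.elim (file x2 [true] [] [] [] [] [] [])
        { G with cU := List.replicate (i + 1) true, cb := ubin (i + 1) }.get)
      (Sum.elim (file x2 [] [] [] [] [] [] [])
        { G with cU := List.replicate (i + 1) true, cb := ubin (i + 1) }.get) 3 :=
    (runs_clear _ _).of_eq (by rw [Sum.update_elim_inl]; simp) (by simp)
  have hval : norm x2 = encodeNat (i + 3) := by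
    rw [norm_eq_encodeNat, hx2, bitsToNat_addRes, hx1, bitsToNat_addRes, bitsToNat_ubin]; rfl
  have h9 : Runs (bk normalize)
      (Sum.elim (file x2 [] [] [] [] [] [] [])
        { G with cU := List.replicate (i + 1) true, cb := ubin (i + 1) }.get)
      (Sum.elim (file (encodeNat (i + 3)) [] [] [] [] [] [] [])
        { G with cU := List.replicate (i + 1) true, cb := ubin (i + 1) }.get) (9 * x2.length + 5) :=
    ((runs_normalize x2 [] [] [] [] []).inl _).of_eq (by rw [hval]) le_rfl
  refine (h1.seq (h2.seq (h3.seq (h4.seq (h5.seq (h6.seq (h7.seq (h8.seq h9)))))))).of_eq rfl ?_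
  nlinarith [hlen0, hlen1, hx1len, hx2len]

end PhaseA


section PhaseA2
open Q

/-- `L(c)`-many bits: the register driving the `m = 32 c L` loop. [folklore] -/
theorem length_encodeNat_succ3 (i : ℕ) : (encodeNat (i + 3)).length = (i + 3).size := by
  rw [← norm_encodeNat, length_norm, bitsToNat_encodeNat]

/-- The summand register `32 c` (`c = i + 1`). [folklore] -/
def smd (i : ℕ) : List Bool := List.replicate 5 false ++ ubin (i + 1)

/-- The width register: `m = 32 c L` in binary (not normalised). [folklore] -/
def wreg (i : ℕ) : List Bool := iterAdd (smd i) (i + 3).size []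

/-- Value of the summand register `32 c`. [folklore] -/
theorem bitsToNat_smd (i : ℕ) : Complexity.bitsToNat (smd i) = 32 * (i + 1) := by
  rw [smd, bitsToNat_append, bitsToNat_ubin]; simp

/-- Length of the summand register. [folklore] -/
theorem length_smd_le (i : ℕ) : (smd i).length ≤ 7 + i := by
  have := length_ubin_le (i + 1)
  simp only [smd, List.length_append, List.length_replicate]; omega

/-- Value of the width register: `width c`. [folklore] -/
theorem bitsToNat_wreg (i : ℕ) : Complexity.bitsToNat (wreg i) = width (i + 1) := by
  rw [wreg, bitsToNat_iterAdd, bitsToNat_smd, show i + 3 = (i + 1) + 2 by ring, size_add_two,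
    width, bitWidth]
  simp; ring

/-- Length of the width register. [folklore] -/
theorem length_wreg_le (i : ℕ) : (wreg i).length ≤ (7 + i) + (i + 3) :=
  (length_iterAdd_le (smd i) _ [] (7 + i) (by simp) (length_smd_le i)).trans
    (Nat.add_le_add_left (size_le_self' i) _)

/-- Candidate step, part 2: keep `L` bits in `lb`, build `tU = 1^{16 L}` (unary `t`), set
`y := 32 c` and add it `L` times: `x = m = 32 c L` in binary. [folklore] -/
def candC2 : Com QR :=
  copy (Sum.inl .x) (Sum.inr lb) (Sum.inl .s) (Sum.inl .t) ;; fillLoop .x tU true 16 ;;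
    copy (Sum.inr cb) (Sum.inl .y) (Sum.inl .s) (Sum.inl .t) ;; pushN (Sum.inl .y) false 5 ;;
    mulAddLoop lb

/-- **Simulation of `candC2`.** [folklore] -/
theorem runs_candC2 (G : QF) (i : ℕ) (hcb : G.cb = ubin (i + 1)) (hlb : G.lb = []) (htU : G.tU = []) :
    Runs candC2 (Sum.elim (file (encodeNat (i + 3)) [] [] [] [] [] [] []) G.get)
      (Sum.elim (file (wreg i) (smd i) [] [] [] [] [] [])
        { G with tU := List.replicate (16 * (i + 3).size) true }.get)
      (800 * (i + 4) ^ 2) := by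
  have hL := length_encodeNat_succ3 i
  have hLle := size_le_self' i
  have hub := length_ubin_le (i + 1)
  set e := encodeNat (i + 3) with he
  have h1 : Runs (copy (Sum.inl AReg.x : QR) (Sum.inr lb) (Sum.inl .s) (Sum.inl .t))
      (Sum.elim (file e [] [] [] [] [] [] []) G.get)
      (Sum.elim (file e [] [] [] [] [] [] []) { G with lb := e }.get) (10 * e.length + 3) :=
    (runs_copy (by decide) (by decide) (by decide) (by decide) (by decide) (by decide) _ rfl rfl).of_eq
      (by rw [Sum.update_elim_inr]; simp [hlb]) (by simp)
  have h2 : Runs (fillLoop .x tU true 16 : Com QR)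
      (Sum.elim (file e [] [] [] [] [] [] []) { G with lb := e }.get)
      (Sum.elim (file [] [] [] [] [] [] [] []) { G with lb := e, tU := List.replicate (16 * (i + 3).size) true }.get)
      ((16 + 2) * e.length + 1) :=
    (runs_fillLoop .x tU true 16 e _ _ rfl).of_eq (by simp [htU, hL]) le_rfl
  have h3 : Runs (copy (Sum.inr cb : QR) (Sum.inl .y) (Sum.inl .s) (Sum.inl .t))
      (Sum.elim (file [] [] [] [] [] [] [] []) { G with lb := e, tU := List.replicate (16 * (i + 3).size) true }.get)
      (Sum.elim (file [] (ubin (i + 1)) [] [] [] [] [] [])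
        { G with lb := e, tU := List.replicate (16 * (i + 3).size) true }.get) (10 * (ubin (i + 1)).length + 3) :=
    (runs_copy (by decide) (by decide) (by decide) (by decide) (by decide) (by decide) _ rfl rfl).of_eq
      (by rw [Sum.update_elim_inl]; simp [hcb]) (by simp [hcb])
  have h4 : Runs (pushN (Sum.inl AReg.y : QR) false 5)
      (Sum.elim (file [] (ubin (i + 1)) [] [] [] [] [] [])
        { G with lb := e, tU := List.replicate (16 * (i + 3).size) true }.get)
      (Sum.elim (file [] (smd i) [] [] [] [] [] [])
        { G with lb := e, tU := List.replicate (16 * (i + 3).size) true }.get) 5 :=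
    (runs_pushN _ _ 5 _).of_eq (by rw [Sum.update_elim_inl]; simp [smd]) le_rfl
  have h5 : Runs (mulAddLoop lb : Com QR)
      (Sum.elim (file [] (smd i) [] [] [] [] [] [])
        { G with lb := e, tU := List.replicate (16 * (i + 3).size) true }.get)
      (Sum.elim (file (wreg i) (smd i) [] [] [] [] [] [])
        { G with lb := ([] : List Bool), tU := List.replicate (16 * (i + 3).size) true }.get)
      ((26 * ((7 + i) + e.length) + 14) * e.length + 1) :=
    (runs_mulAddLoop lb e [] (smd i) [] [] [] (7 + i) (by simp) (length_smd_le i) _ (by simp)).of_eq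
      (by simp [wreg, hL]) le_rfl
  have e6 : ({ G with lb := ([] : List Bool), tU := List.replicate (16 * (i + 3).size) true } : QF) =
      { G with tU := List.replicate (16 * (i + 3).size) true } := by
    cases G; simp only at hlb; simp [hlb]
  rw [e6] at h5
  refine (h1.seq (h2.seq (h3.seq (h4.seq h5)))).of_eq rfl ?_
  rw [hL]
  nlinarith [hLle, hub]

/-- The key-length register: `keyLen c = c (m t) + m` in binary (not normalised). [folklore] -/
def kreg (i : ℕ) : List Bool :=
  addRes (iterAdd (iterAdd (wreg i) (16 * (i + 3).size) []) (i + 1) []) (wreg i)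

/-- Value of the key-length register: `keyLen c`. [folklore] -/
theorem bitsToNat_kreg (i : ℕ) : Complexity.bitsToNat (kreg i) = keyLen (i + 1) := by
  rw [kreg, bitsToNat_addRes, bitsToNat_iterAdd, bitsToNat_iterAdd, bitsToNat_wreg, keyLen,
    bitWidth, show i + 3 = (i + 1) + 2 by ring, size_add_two]
  simp; ring

/-- Length of the key-length register. [folklore] -/
theorem length_kreg_le (i : ℕ) : (kreg i).length ≤ 60 * (i + 4) := by
  have hw := length_wreg_le i
  have hL := size_le_self' i
  have h1 : (iterAdd (wreg i) (16 * (i + 3).size) []).length ≤ ((7 + i) + (i + 3)) + 16 * (i + 3).size :=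
    length_iterAdd_le _ _ [] _ (by simp) hw
  have h2 : (iterAdd (iterAdd (wreg i) (16 * (i + 3).size) []) (i + 1) []).length ≤
      (((7 + i) + (i + 3)) + 16 * (i + 3).size) + (i + 1) :=
    length_iterAdd_le _ _ [] _ (by simp) h1
  have h3 := length_addRes_le_max (iterAdd (iterAdd (wreg i) (16 * (i + 3).size) []) (i + 1) []) (wreg i)
  rw [kreg]
  have : max (iterAdd (iterAdd (wreg i) (16 * (i + 3).size) []) (i + 1) []).length (wreg i).length ≤
      (((7 + i) + (i + 3)) + 16 * (i + 3).size) + (i + 1) := max_le h2 (by omega)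
  nlinarith [this, h3, hL]

/-- Candidate step, part 3: `x := c · (m · t) + m = keyLen c` (adding `m` `16 L` times, the result
`c` times, and `m` once more; `m` is parked in `mb` meanwhile). [folklore] -/
def candC3 : Com QR :=
  clear (Sum.inl .y) ;; move (Sum.inl .x) (Sum.inl .y) (Sum.inl .s) ;;
    copy (Sum.inl .y) (Sum.inr mb) (Sum.inl .s) (Sum.inl .t) ;;
    copy (Sum.inr tU) (Sum.inr tC) (Sum.inl .s) (Sum.inl .t) ;; mulAddLoop tC ;;
    clear (Sum.inl .y) ;; move (Sum.inl .x) (Sum.inl .y) (Sum.inl .s) ;;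
    copy (Sum.inr cU) (Sum.inr cC) (Sum.inl .s) (Sum.inl .t) ;; mulAddLoop cC ;;
    clear (Sum.inl .y) ;; move (Sum.inr mb) (Sum.inl .y) (Sum.inl .s) ;; bk add ;; clear (Sum.inl .y)

/-- **Simulation of `candC3`.** [folklore] -/
theorem runs_candC3 (G : QF) (i : ℕ) (hcU : G.cU = List.replicate (i + 1) true)
    (htU : G.tU = List.replicate (16 * (i + 3).size) true) (hmb : G.mb = []) (htC : G.tC = [])
    (hcC : G.cC = []) :
    Runs candC3 (Sum.elim (file (wreg i) (smd i) [] [] [] [] [] []) G.get)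
      (Sum.elim (file (kreg i) [] [] [] [] [] [] []) G.get)
      (60000 * (i + 4) ^ 2) := by
  have hw := length_wreg_le i
  have hL := size_le_self' i
  have hs := length_smd_le i
  set W := wreg i with hW
  set T := List.replicate (16 * (i + 3).size) true with hT
  set C := List.replicate (i + 1) true with hC
  have hTlen : T.length = 16 * (i + 3).size := by simp [hT]
  have hClen : C.length = i + 1 := by simp [hC]
  -- y := m, mb := m
  have h1 : Runs (clear (Sum.inl AReg.y : QR)) (Sum.elim (file W (smd i) [] [] [] [] [] []) G.get)
      (Sum.elim (file W [] [] [] [] [] [] []) G.get) (2 * (smd i).length + 1) :=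
    (runs_clear _ _).of_eq (by rw [Sum.update_elim_inl]; simp) (by simp)
  have h2 : Runs (move (Sum.inl AReg.x : QR) (Sum.inl .y) (Sum.inl .s)) (Sum.elim (file W [] [] [] [] [] [] []) G.get)
      (Sum.elim (file [] W [] [] [] [] [] []) G.get) (6 * W.length + 2) :=
    (runs_move (by decide) (by decide) (by decide) _ rfl).of_eq
      (by rw [Sum.update_elim_inl, Sum.update_elim_inl]; simp) (by simp)
  have h3 : Runs (copy (Sum.inl AReg.y : QR) (Sum.inr mb) (Sum.inl .s) (Sum.inl .t))
      (Sum.elim (file [] W [] [] [] [] [] []) G.get)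
      (Sum.elim (file [] W [] [] [] [] [] []) { G with mb := W }.get) (10 * W.length + 3) :=
    (runs_copy (by decide) (by decide) (by decide) (by decide) (by decide) (by decide) _ rfl rfl).of_eq
      (by rw [Sum.update_elim_inr]; simp [hmb]) (by simp)
  -- x := m t
  have h4 : Runs (copy (Sum.inr tU : QR) (Sum.inr tC) (Sum.inl .s) (Sum.inl .t))
      (Sum.elim (file [] W [] [] [] [] [] []) { G with mb := W }.get)
      (Sum.elim (file [] W [] [] [] [] [] []) { G with mb := W, tC := T }.get) (10 * T.length + 3) :=
    (runs_copy (by decide) (by decide) (by decide) (by decide) (by decide) (by decide) _ rfl rfl).of_eq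
      (by rw [Sum.update_elim_inr]; simp [htU, htC, hT]) (by simp [htU, hT])
  set X1 := iterAdd W (16 * (i + 3).size) [] with hX1
  have hX1len : X1.length ≤ ((7 + i) + (i + 3)) + 16 * (i + 3).size :=
    length_iterAdd_le _ _ [] _ (by simp) hw
  have h5 : Runs (mulAddLoop tC : Com QR)
      (Sum.elim (file [] W [] [] [] [] [] []) { G with mb := W, tC := T }.get)
      (Sum.elim (file X1 W [] [] [] [] [] []) { G with mb := W, tC := ([] : List Bool) }.get)
      ((26 * (((7 + i) + (i + 3)) + T.length) + 14) * T.length + 1) :=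
    (runs_mulAddLoop tC T [] W [] [] [] ((7 + i) + (i + 3)) (by simp) hw _ (by simp)).of_eq
      (by simp [hX1, hTlen]) le_rfl
  -- x := c (m t)
  have h6 : Runs (clear (Sum.inl AReg.y : QR))
      (Sum.elim (file X1 W [] [] [] [] [] []) { G with mb := W, tC := ([] : List Bool) }.get)
      (Sum.elim (file X1 [] [] [] [] [] [] []) { G with mb := W, tC := ([] : List Bool) }.get) (2 * W.length + 1) :=
    (runs_clear _ _).of_eq (by rw [Sum.update_elim_inl]; simp) (by simp)
  have h7 : Runs (move (Sum.inl AReg.x : QR) (Sum.inl .y) (Sum.inl .s))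
      (Sum.elim (file X1 [] [] [] [] [] [] []) { G with mb := W, tC := ([] : List Bool) }.get)
      (Sum.elim (file [] X1 [] [] [] [] [] []) { G with mb := W, tC := ([] : List Bool) }.get) (6 * X1.length + 2) :=
    (runs_move (by decide) (by decide) (by decide) _ rfl).of_eq
      (by rw [Sum.update_elim_inl, Sum.update_elim_inl]; simp) (by simp)
  have h8 : Runs (copy (Sum.inr cU : QR) (Sum.inr cC) (Sum.inl .s) (Sum.inl .t))
      (Sum.elim (file [] X1 [] [] [] [] [] []) { G with mb := W, tC := ([] : List Bool) }.get)
      (Sum.elim (file [] X1 [] [] [] [] [] []) { G with mb := W, tC := ([] : List Bool), cC := C }.get)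
      (10 * C.length + 3) :=
    (runs_copy (by decide) (by decide) (by decide) (by decide) (by decide) (by decide) _ rfl rfl).of_eq
      (by rw [Sum.update_elim_inr]; simp [hcU, hcC, hC]) (by simp [hcU, hC])
  set X2 := iterAdd X1 (i + 1) [] with hX2
  have hX2len : X2.length ≤ (((7 + i) + (i + 3)) + 16 * (i + 3).size) + (i + 1) :=
    length_iterAdd_le _ _ [] _ (by simp) hX1len
  have h9 : Runs (mulAddLoop cC : Com QR)
      (Sum.elim (file [] X1 [] [] [] [] [] []) { G with mb := W, tC := ([] : List Bool), cC := C }.get)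
      (Sum.elim (file X2 X1 [] [] [] [] [] []) { G with mb := W, tC := ([] : List Bool), cC := ([] : List Bool) }.get)
      ((26 * ((((7 + i) + (i + 3)) + 16 * (i + 3).size) + C.length) + 14) * C.length + 1) :=
    (runs_mulAddLoop cC C [] X1 [] [] [] _ (by simp) hX1len _ (by simp)).of_eq
      (by simp [hX2, hClen]) le_rfl
  -- x := c (m t) + m
  have h10 : Runs (clear (Sum.inl AReg.y : QR))
      (Sum.elim (file X2 X1 [] [] [] [] [] []) { G with mb := W, tC := ([] : List Bool), cC := ([] : List Bool) }.get)
      (Sum.elim (file X2 [] [] [] [] [] [] []) { G with mb := W, tC := ([] : List Bool), cC := ([] : List Bool) }.get)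
      (2 * X1.length + 1) :=
    (runs_clear _ _).of_eq (by rw [Sum.update_elim_inl]; simp) (by simp)
  have h11 : Runs (move (Sum.inr mb : QR) (Sum.inl .y) (Sum.inl .s))
      (Sum.elim (file X2 [] [] [] [] [] [] []) { G with mb := W, tC := ([] : List Bool), cC := ([] : List Bool) }.get)
      (Sum.elim (file X2 W [] [] [] [] [] []) { G with mb := ([] : List Bool), tC := ([] : List Bool), cC := ([] : List Bool) }.get)
      (6 * W.length + 2) :=
    (runs_move (by decide) (by decide) (by decide) _ rfl).of_eq
      (by rw [Sum.update_elim_inr, Sum.update_elim_inl]; simp) (by simp)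
  have h12 : Runs (bk add)
      (Sum.elim (file X2 W [] [] [] [] [] []) { G with mb := ([] : List Bool), tC := ([] : List Bool), cC := ([] : List Bool) }.get)
      (Sum.elim (file (kreg i) W [] [] [] [] [] []) { G with mb := ([] : List Bool), tC := ([] : List Bool), cC := ([] : List Bool) }.get)
      (13 * (X2.length + W.length) + 12) :=
    ((runs_add X2 W [] [] []).inl _).of_eq (by simp [kreg, hX2, hX1, hW]) le_rfl
  have h13 : Runs (clear (Sum.inl AReg.y : QR))
      (Sum.elim (file (kreg i) W [] [] [] [] [] []) { G with mb := ([] : List Bool), tC := ([] : List Bool), cC := ([] : List Bool) }.get)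
      (Sum.elim (file (kreg i) [] [] [] [] [] [] []) { G with mb := ([] : List Bool), tC := ([] : List Bool), cC := ([] : List Bool) }.get)
      (2 * W.length + 1) :=
    (runs_clear _ _).of_eq (by rw [Sum.update_elim_inl]; simp) (by simp)
  have e14 : ({ G with mb := ([] : List Bool), tC := ([] : List Bool), cC := ([] : List Bool) } : QF) = G := by
    cases G; simp only at hmb htC hcC; simp [hmb, htC, hcC]
  replace h13 := h13.congr (congrArg (Sum.elim _) (congrArg QF.get e14))
  refine (h1.seq (h2.seq (h3.seq (h4.seq (h5.seq (h6.seq (h7.seq (h8.seq (h9.seq (h10.seq (h11.seq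
    (h12.seq h13)))))))))))).of_eq rfl ?_
  rw [hTlen, hClen]
  nlinarith [hw, hL, hs, hX1len, hX2len]

end PhaseA2


section PhaseA3
open Q

/-- The outcome of candidate `c = i + 1`: one more `true` on `nU` iff `keyLen c ≤ k`. [folklore] -/
def hit (k i : ℕ) : List Bool := if keyLen (i + 1) ≤ k then [true] else []

/-- Candidate step, part 4: compare `keyLen c` with `k` (subtraction with borrow flag) and record
a hit on `nU`; clean up `x`, `y`, `tU`. [folklore] -/
def candC4 : Com QR :=
  move (Sum.inl .x) (Sum.inl .y) (Sum.inl .s) ;; copy (Sum.inr kb) (Sum.inl .x) (Sum.inl .s) (Sum.inl .t) ;;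
    bk sub ;; pop (Sum.inl .g) (push (Sum.inr nU) true) skip skip ;;
    clear (Sum.inl .x) ;; clear (Sum.inl .y) ;; clear (Sum.inr tU)

/-- **Simulation of `candC4`.** [folklore] -/
theorem runs_candC4 (G : QF) (k i : ℕ) (hkb : G.kb = ubin k)
    (htU : G.tU = List.replicate (16 * (i + 3).size) true) :
    Runs candC4 (Sum.elim (file (kreg i) [] [] [] [] [] [] []) G.get)
      (Sum.elim bank0 { G with nU := hit k i ++ G.nU, tU := [] }.get)
      (2000 * (i + 4) + 40 * (k + 4)) := by
  have hK := length_kreg_le i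
  have hL := size_le_self' i
  have hub := length_ubin_le k
  set K := kreg i with hKdef
  have h1 : Runs (move (Sum.inl AReg.x : QR) (Sum.inl .y) (Sum.inl .s)) (Sum.elim (file K [] [] [] [] [] [] []) G.get)
      (Sum.elim (file [] K [] [] [] [] [] []) G.get) (6 * K.length + 2) :=
    (runs_move (by decide) (by decide) (by decide) _ rfl).of_eq
      (by rw [Sum.update_elim_inl, Sum.update_elim_inl]; simp) (by simp)
  have h2 : Runs (copy (Sum.inr kb : QR) (Sum.inl .x) (Sum.inl .s) (Sum.inl .t))
      (Sum.elim (file [] K [] [] [] [] [] []) G.get)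
      (Sum.elim (file (ubin k) K [] [] [] [] [] []) G.get) (10 * (ubin k).length + 3) :=
    (runs_copy (by decide) (by decide) (by decide) (by decide) (by decide) (by decide) _ rfl rfl).of_eq
      (by rw [Sum.update_elim_inl]; simp [hkb]) (by simp [hkb])
  set b := subBorrow (ubin k) K with hb
  have hbval : b = decide (k < keyLen (i + 1)) := by
    rw [hb, subBorrow_iff, bitsToNat_ubin, hKdef, bitsToNat_kreg]
  set X := (bif b then ubin k else subRes (ubin k) K) with hX
  have hXlen : X.length ≤ 1 + k := by
    rw [hX]; cases b
    · simp [length_subRes]; exact hub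
    · simpa using hub
  have h3 : Runs (bk sub) (Sum.elim (file (ubin k) K [] [] [] [] [] []) G.get)
      (Sum.elim (file X K [] [] [] [] [] (flag !b)) G.get) (16 * ((ubin k).length + K.length) + 12) :=
    ((runs_sub (ubin k) K []).inl _).of_eq (by simp [hX, hb]) le_rfl
  have h4 : Runs (pop (Sum.inl AReg.g : QR) (push (Sum.inr nU) true) skip skip)
      (Sum.elim (file X K [] [] [] [] [] (flag !b)) G.get)
      (Sum.elim (file X K [] [] [] [] [] []) { G with nU := hit k i ++ G.nU }.get) 3 := by
    by_cases hle : keyLen (i + 1) ≤ k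
    · have hbf : b = false := by rw [hbval]; simp [not_lt.2 hle]
      have hhit : hit k i = [true] := if_pos hle
      rw [hbf, hhit]
      have hp : Runs (push (Sum.inr nU : QR) true) (Sum.elim (file X K [] [] [] [] [] []) G.get)
          (Sum.elim (file X K [] [] [] [] [] []) { G with nU := [true] ++ G.nU }.get) 1 :=
        Runs.push' (by rw [Sum.update_elim_inr]; simp)
      exact Runs.pop_true' _ _ (R := Sum.elim (file X K [] [] [] [] [] (flag !false)) G.get) (w := [])
        rfl (by rw [Sum.update_elim_inl]; simp) hp
    · have hbt : b = true := by rw [hbval]; simp [lt_of_not_ge hle]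
      have hhit : hit k i = [] := if_neg hle
      rw [hbt, hhit]
      exact (Runs.pop_nil _ _ (R := Sum.elim (file X K [] [] [] [] [] (flag !true)) G.get) rfl
        (Runs.skip _)).of_eq (by simp) (by norm_num)
  have h5 : Runs (clear (Sum.inl AReg.x : QR))
      (Sum.elim (file X K [] [] [] [] [] []) { G with nU := hit k i ++ G.nU }.get)
      (Sum.elim (file [] K [] [] [] [] [] []) { G with nU := hit k i ++ G.nU }.get) (2 * X.length + 1) :=
    (runs_clear _ _).of_eq (by rw [Sum.update_elim_inl]; simp) (by simp)
  have h6 : Runs (clear (Sum.inl AReg.y : QR))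
      (Sum.elim (file [] K [] [] [] [] [] []) { G with nU := hit k i ++ G.nU }.get)
      (Sum.elim bank0 { G with nU := hit k i ++ G.nU }.get) (2 * K.length + 1) :=
    (runs_clear _ _).of_eq (by rw [Sum.update_elim_inl]; simp) (by simp)
  have h7 : Runs (clear (Sum.inr tU : QR))
      (Sum.elim bank0 { G with nU := hit k i ++ G.nU }.get)
      (Sum.elim bank0 { G with nU := hit k i ++ G.nU, tU := [] }.get) (2 * (16 * (i + 3).size) + 1) :=
    (runs_clear _ _).of_eq (by rw [Sum.update_elim_inr]; simp) (by simp [htU])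
  refine (h1.seq (h2.seq (h3.seq (h4.seq (h5.seq (h6.seq h7)))))).of_eq rfl ?_
  nlinarith [hK, hL, hub, hXlen]

/-- **One candidate step** of phase A: try `c = i + 1`. [folklore] -/
def candStep : Com QR := candC1 ;; candC2 ;; candC3 ;; candC4

/-- **Simulation of `candStep`.** [folklore] -/
theorem runs_candStep (G : QF) (k i : ℕ) (hcU : G.cU = List.replicate i true) (hcb : G.cb = ubin i)
    (hkb : G.kb = ubin k) (hlb : G.lb = []) (htU : G.tU = []) (hmb : G.mb = []) (htC : G.tC = [])
    (hcC : G.cC = []) :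
    Runs candStep (Sum.elim bank0 G.get)
      (Sum.elim bank0
        { G with cU := List.replicate (i + 1) true, cb := ubin (i + 1), nU := hit k i ++ G.nU }.get)
      (63000 * (i + 4) ^ 2 + 40 * (k + 4)) := by
  have h1 := runs_candC1 G i hcU hcb
  have h2 := runs_candC2 { G with cU := List.replicate (i + 1) true, cb := ubin (i + 1) } i rfl hlb htU
  have h3 := runs_candC3
    { G with cU := List.replicate (i + 1) true, cb := ubin (i + 1), tU := List.replicate (16 * (i + 3).size) true }
    i rfl rfl hmb htC hcC
  have h4 := runs_candC4
    { G with cU := List.replicate (i + 1) true, cb := ubin (i + 1), tU := List.replicate (16 * (i + 3).size) true }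
    k i hkb rfl
  refine (h1.seq (h2.seq (h3.seq h4))).of_eq ?_ (by nlinarith)
  cases G; simp only at htU; simp [htU]

/-- The number of hits among the candidates `1, …, i`. [folklore] -/
def cnt (k : ℕ) : ℕ → ℕ
  | 0 => 0
  | i + 1 => cnt k i + (if keyLen (i + 1) ≤ k then 1 else 0)

/-- The hits are exactly the candidates up to `dimOf k`. [folklore] -/
theorem cnt_eq_min (k : ℕ) : ∀ i, cnt k i = min i (dimOf k)
  | 0 => by simp [cnt]
  | i + 1 => by
    rw [cnt, cnt_eq_min k i]
    by_cases h : keyLen (i + 1) ≤ k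
    · have : i + 1 ≤ dimOf k := le_dimOf h
      rw [if_pos h, min_eq_left this, min_eq_left (by omega)]
    · rw [if_neg h, add_zero]
      have : dimOf k ≤ i := by
        by_contra h'
        push Not at h'
        exact h ((keyLen_strictMono.monotone (show i + 1 ≤ dimOf k by omega)).trans (keyLen_dimOf_le k))
      rw [min_eq_right this, min_eq_right (by omega)]

/-- After all `k` candidates the count is `dimOf k`. [folklore] -/
theorem cnt_self (k : ℕ) : cnt k k = dimOf k := by
  have h : dimOf k ≤ k := Nat.findGreatest_le (P := fun n => keyLen n ≤ k) k
  rw [cnt_eq_min, min_eq_right h]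

/-- `hit` in front of the unary count. [folklore] -/
theorem hit_append_replicate (k i : ℕ) :
    hit k i ++ List.replicate (cnt k i) true = List.replicate (cnt k (i + 1)) true := by
  rw [cnt, hit]
  split_ifs
  · rw [Nat.add_comm, List.replicate_add]; rfl
  · rfl

/-- The invariant states of the candidate loop. [folklore] -/
def stA (z : List Bool) (i : ℕ) : QF :=
  { inp := z, kb := ubin z.length, cU := List.replicate i true, cb := ubin i,
    nU := List.replicate (cnt z.length i) true }

/-- **Phase A**: `A0`, then one candidate step per input bit. [folklore] -/
def phaseA : Com QR := phaseA0 ;; loop (Sum.inr fuel) candStep candStep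

/-- A budget for phase A. [folklore] -/
def budgetA : Polynomial ℕ := 64000 * (X + 4) ^ 3

/-- **Simulation of phase A**: afterwards `nU = 1^{dimOf k}`, `cU = 1^k`, `cb = k`, `kb = k`,
all other registers as at the start. [folklore] -/
theorem runs_phaseA (z : List Bool) :
    Runs phaseA (Sum.elim bank0 ({ inp := z } : QF).get)
      (Sum.elim bank0 (stA z z.length).get) (budgetA.eval z.length) := by
  have h0 := runs_phaseA0 z
  have hΦ : ∀ i, (Sum.elim bank0 (stA z i).get : Regs QR) (Sum.inr fuel) = [] := fun i => rfl
  have hloop := runs_indexLoop (c := (Sum.inr fuel : QR)) (body := candStep)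
    (fun i => Sum.elim bank0 (stA z i).get) (63000 * (z.length + 4) ^ 2 + 40 * (z.length + 4)) hΦ z 0
    (fun i _ hi w => by
      have hi' : i < z.length := by simpa using hi
      rw [Sum.update_elim_inr, QF.update_fuel, Sum.update_elim_inr, QF.update_fuel]
      refine (runs_candStep ({ stA z i with fuel := w } : QF) z.length i rfl rfl rfl rfl rfl rfl rfl
        rfl).of_eq ?_ ?_
      · simp [stA, hit_append_replicate]
      · have : (i + 4) ^ 2 ≤ (z.length + 4) ^ 2 := Nat.pow_le_pow_left (by omega) 2
        nlinarith [this])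
  have hstart : Function.update (Sum.elim bank0 (stA z 0).get : Regs QR) (Sum.inr fuel) z =
      Sum.elim bank0 ({ inp := z, fuel := z, kb := ubin z.length } : QF).get := by
    rw [Sum.update_elim_inr, QF.update_fuel]; rfl
  rw [hstart, Nat.zero_add] at hloop
  refine (h0.seq hloop).of_eq rfl ?_
  simp only [budgetA, eval_mul, eval_pow, eval_add, eval_X, eval_ofNat]
  nlinarith

end PhaseA3


/-! ### Phase B: the parameters `t`, `m` for the dimension `n` -/

section PhaseB
open Q

/-- The summand `32 n` for the width. [folklore] -/
def smdN (n : ℕ) : List Bool := List.replicate 5 false ++ ubin n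

/-- The width `m = 32 n L` in binary (not normalised), `L = size (n + 2)`. [folklore] -/
def wbin (n : ℕ) : List Bool := iterAdd (smdN n) (n + 2).size []

/-- Value of the summand `32 n`. [folklore] -/
theorem bitsToNat_smdN (n : ℕ) : Complexity.bitsToNat (smdN n) = 32 * n := by
  rw [smdN, bitsToNat_append, bitsToNat_ubin]; simp

/-- Length of the summand `32 n`. [folklore] -/
theorem length_smdN_le (n : ℕ) : (smdN n).length ≤ 6 + n := by
  have := length_ubin_le n
  simp only [smdN, List.length_append, List.length_replicate]; omega

/-- Value of `wbin`: `width n`. [folklore] -/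
theorem bitsToNat_wbin (n : ℕ) : Complexity.bitsToNat (wbin n) = width n := by
  rw [wbin, bitsToNat_iterAdd, bitsToNat_smdN, size_add_two, width, bitWidth]; simp; ring

/-- `size (n + 2) ≤ n + 2`. [folklore] -/
theorem size_add_two_le (n : ℕ) : (n + 2).size ≤ n + 2 := Nat.size_le.2 Nat.lt_two_pow_self

/-- Length of `wbin`. [folklore] -/
theorem length_wbin_le (n : ℕ) : (wbin n).length ≤ (6 + n) + (n + 2) :=
  (length_iterAdd_le (smdN n) _ [] (6 + n) (by simp) (length_smdN_le n)).trans
    (Nat.add_le_add_left (size_add_two_le n) _)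

/-- `16 · size (n+2) = bitWidth n` and `32 n size(n+2) = width n`. [folklore] -/
theorem sixteen_mul_size (n : ℕ) : 16 * (n + 2).size = bitWidth n := by
  rw [size_add_two, bitWidth]

/-- `2 · 16 size(n+2) · n = width n`. [folklore] -/
theorem thirtytwo_mul_size (n : ℕ) : 2 * (16 * (n + 2).size) * n = width n := by
  rw [size_add_two, width, bitWidth]; ring

/-- Phase B1: `x := n` (count `nU`), `x := n + 2`, normalise (`L` bits), `tU := 1^{16 L}` keeping
the `L` bits in `lb`; then `y := 32 n`, `x := 32 n L = m`, parked in `mb`. [folklore] -/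
def phaseB1 : Com QR :=
  copy (Sum.inr nU) (Sum.inr nC) (Sum.inl .s) (Sum.inl .t) ;; push (Sum.inl .y) true ;; mulAddLoop nC ;;
    bk add ;; bk add ;; clear (Sum.inl .y) ;; bk normalize ;;
    copy (Sum.inl .x) (Sum.inr lb) (Sum.inl .s) (Sum.inl .t) ;; fillLoop .x tU true 16 ;;
    copy (Sum.inr nU) (Sum.inr nC) (Sum.inl .s) (Sum.inl .t) ;; push (Sum.inl .y) true ;; mulAddLoop nC ;;
    clear (Sum.inl .y) ;; move (Sum.inl .x) (Sum.inl .y) (Sum.inl .s) ;; pushN (Sum.inl .y) false 5 ;;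
    mulAddLoop lb ;; clear (Sum.inl .y) ;; move (Sum.inl .x) (Sum.inr mb) (Sum.inl .s)

/-- **Simulation of phase B1.** [folklore] -/
theorem runs_phaseB1 (G : QF) (n : ℕ) (hnU : G.nU = List.replicate n true) (hnC : G.nC = [])
    (hlb : G.lb = []) (htU : G.tU = []) (hmb : G.mb = []) :
    Runs phaseB1 (Sum.elim bank0 G.get)
      (Sum.elim bank0 { G with tU := List.replicate (16 * (n + 2).size) true, mb := wbin n }.get)
      (2000 * (n + 3) ^ 2) := by
  have hub := length_ubin_le n
  have hL := size_add_two_le n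
  have hsm := length_smdN_le n
  have hwb := length_wbin_le n
  set N := List.replicate n true with hN
  have hNlen : N.length = n := by simp [hN]
  -- x := n
  have h1 : Runs (copy (Sum.inr nU : QR) (Sum.inr nC) (Sum.inl .s) (Sum.inl .t)) (Sum.elim bank0 G.get)
      (Sum.elim bank0 { G with nC := N }.get) (10 * N.length + 3) :=
    (runs_copy (by decide) (by decide) (by decide) (by decide) (by decide) (by decide) _ rfl rfl).of_eq
      (by rw [Sum.update_elim_inr]; simp [hnU, hnC, hN]) (by simp [hnU, hN])
  have h2 : Runs (push (Sum.inl AReg.y : QR) true) (Sum.elim bank0 { G with nC := N }.get)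
      (Sum.elim (file [] [true] [] [] [] [] [] []) { G with nC := N }.get) 1 :=
    Runs.push' (by rw [Sum.update_elim_inl]; simp)
  have h3 : Runs (mulAddLoop nC : Com QR) (Sum.elim (file [] [true] [] [] [] [] [] []) { G with nC := N }.get)
      (Sum.elim (file (ubin n) [true] [] [] [] [] [] []) { G with nC := ([] : List Bool) }.get)
      ((26 * (1 + N.length) + 14) * N.length + 1) :=
    (runs_mulAddLoop nC N [] [true] [] [] [] 1 (by simp) (by simp) _ (by simp)).of_eq
      (by simp [ubin, hNlen]) le_rfl
  -- x := n + 2, normalised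
  set x1 := addRes (ubin n) [true] with hx1
  have hx1len : x1.length ≤ 2 + n := by
    have := length_addRes_le_max (ubin n) [true]
    rw [← hx1] at this; simp only [List.length_singleton] at this; omega
  have h4 : Runs (bk add) (Sum.elim (file (ubin n) [true] [] [] [] [] [] []) { G with nC := ([] : List Bool) }.get)
      (Sum.elim (file x1 [true] [] [] [] [] [] []) { G with nC := ([] : List Bool) }.get) (13 * ((ubin n).length + 1) + 12) :=
    ((runs_add (ubin n) [true] [] [] []).inl _).of_eq rfl (by simp)
  set x2 := addRes x1 [true] with hx2
  have hx2len : x2.length ≤ 3 + n := by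
    have := length_addRes_le_max x1 [true]
    rw [← hx2] at this; simp only [List.length_singleton] at this; omega
  have h5 : Runs (bk add) (Sum.elim (file x1 [true] [] [] [] [] [] []) { G with nC := ([] : List Bool) }.get)
      (Sum.elim (file x2 [true] [] [] [] [] [] []) { G with nC := ([] : List Bool) }.get) (13 * (x1.length + 1) + 12) :=
    ((runs_add x1 [true] [] [] []).inl _).of_eq rfl (by simp)
  have h6 : Runs (clear (Sum.inl AReg.y : QR)) (Sum.elim (file x2 [true] [] [] [] [] [] []) { G with nC := ([] : List Bool) }.get)
      (Sum.elim (file x2 [] [] [] [] [] [] []) { G with nC := ([] : List Bool) }.get) 3 :=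
    (runs_clear _ _).of_eq (by rw [Sum.update_elim_inl]; simp) (by simp)
  have hval : norm x2 = encodeNat (n + 2) := by
    rw [norm_eq_encodeNat, hx2, bitsToNat_addRes, hx1, bitsToNat_addRes, bitsToNat_ubin]; rfl
  set e := encodeNat (n + 2) with he
  have helen : e.length = (n + 2).size := by rw [he, ← norm_encodeNat, length_norm, bitsToNat_encodeNat]
  have h7 : Runs (bk normalize) (Sum.elim (file x2 [] [] [] [] [] [] []) { G with nC := ([] : List Bool) }.get)
      (Sum.elim (file e [] [] [] [] [] [] []) { G with nC := ([] : List Bool) }.get) (9 * x2.length + 5) :=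
    ((runs_normalize x2 [] [] [] [] []).inl _).of_eq (by rw [hval]) le_rfl
  -- lb := L bits, tU := 1^{16 L}
  have h8 : Runs (copy (Sum.inl AReg.x : QR) (Sum.inr lb) (Sum.inl .s) (Sum.inl .t))
      (Sum.elim (file e [] [] [] [] [] [] []) { G with nC := ([] : List Bool) }.get)
      (Sum.elim (file e [] [] [] [] [] [] []) { G with nC := ([] : List Bool), lb := e }.get) (10 * e.length + 3) :=
    (runs_copy (by decide) (by decide) (by decide) (by decide) (by decide) (by decide) _ rfl rfl).of_eq
      (by rw [Sum.update_elim_inr]; simp [hlb]) (by simp)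
  have h9 : Runs (fillLoop .x tU true 16 : Com QR)
      (Sum.elim (file e [] [] [] [] [] [] []) { G with nC := ([] : List Bool), lb := e }.get)
      (Sum.elim bank0 { G with nC := ([] : List Bool), lb := e, tU := List.replicate (16 * (n + 2).size) true }.get)
      ((16 + 2) * e.length + 1) :=
    (runs_fillLoop .x tU true 16 e _ _ rfl).of_eq (by simp [htU, helen]) le_rfl
  set G1 : QF := { G with nC := ([] : List Bool), lb := e, tU := List.replicate (16 * (n + 2).size) true } with hG1
  -- x := n again, y := 32 n
  have h10 : Runs (copy (Sum.inr nU : QR) (Sum.inr nC) (Sum.inl .s) (Sum.inl .t)) (Sum.elim bank0 G1.get)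
      (Sum.elim bank0 { G1 with nC := N }.get) (10 * N.length + 3) :=
    (runs_copy (by decide) (by decide) (by decide) (by decide) (by decide) (by decide) _ rfl rfl).of_eq
      (by rw [Sum.update_elim_inr]; simp [hG1, hnU, hN]) (by simp [hG1, hnU, hN])
  have h11 : Runs (push (Sum.inl AReg.y : QR) true) (Sum.elim bank0 { G1 with nC := N }.get)
      (Sum.elim (file [] [true] [] [] [] [] [] []) { G1 with nC := N }.get) 1 :=
    Runs.push' (by rw [Sum.update_elim_inl]; simp)
  have h12 : Runs (mulAddLoop nC : Com QR) (Sum.elim (file [] [true] [] [] [] [] [] []) { G1 with nC := N }.get)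
      (Sum.elim (file (ubin n) [true] [] [] [] [] [] []) { G1 with nC := ([] : List Bool) }.get)
      ((26 * (1 + N.length) + 14) * N.length + 1) :=
    (runs_mulAddLoop nC N [] [true] [] [] [] 1 (by simp) (by simp) _ (by simp)).of_eq
      (by simp [ubin, hNlen]) le_rfl
  have h13 : Runs (clear (Sum.inl AReg.y : QR))
      (Sum.elim (file (ubin n) [true] [] [] [] [] [] []) { G1 with nC := ([] : List Bool) }.get)
      (Sum.elim (file (ubin n) [] [] [] [] [] [] []) { G1 with nC := ([] : List Bool) }.get) 3 :=
    (runs_clear _ _).of_eq (by rw [Sum.update_elim_inl]; simp) (by simp)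
  have h14 : Runs (move (Sum.inl AReg.x : QR) (Sum.inl .y) (Sum.inl .s))
      (Sum.elim (file (ubin n) [] [] [] [] [] [] []) { G1 with nC := ([] : List Bool) }.get)
      (Sum.elim (file [] (ubin n) [] [] [] [] [] []) { G1 with nC := ([] : List Bool) }.get) (6 * (ubin n).length + 2) :=
    (runs_move (by decide) (by decide) (by decide) _ rfl).of_eq
      (by rw [Sum.update_elim_inl, Sum.update_elim_inl]; simp) (by simp)
  have h15 : Runs (pushN (Sum.inl AReg.y : QR) false 5)
      (Sum.elim (file [] (ubin n) [] [] [] [] [] []) { G1 with nC := ([] : List Bool) }.get)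
      (Sum.elim (file [] (smdN n) [] [] [] [] [] []) { G1 with nC := ([] : List Bool) }.get) 5 :=
    (runs_pushN _ _ 5 _).of_eq (by rw [Sum.update_elim_inl]; simp [smdN]) le_rfl
  -- x := m
  have h16 : Runs (mulAddLoop lb : Com QR)
      (Sum.elim (file [] (smdN n) [] [] [] [] [] []) { G1 with nC := ([] : List Bool) }.get)
      (Sum.elim (file (wbin n) (smdN n) [] [] [] [] [] []) { G1 with nC := ([] : List Bool), lb := ([] : List Bool) }.get)
      ((26 * ((6 + n) + e.length) + 14) * e.length + 1) :=
    (runs_mulAddLoop lb e [] (smdN n) [] [] [] (6 + n) (by simp) hsm _ (by simp [hG1])).of_eq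
      (by simp [wbin, helen]) le_rfl
  have h17 : Runs (clear (Sum.inl AReg.y : QR))
      (Sum.elim (file (wbin n) (smdN n) [] [] [] [] [] []) { G1 with nC := ([] : List Bool), lb := ([] : List Bool) }.get)
      (Sum.elim (file (wbin n) [] [] [] [] [] [] []) { G1 with nC := ([] : List Bool), lb := ([] : List Bool) }.get)
      (2 * (smdN n).length + 1) :=
    (runs_clear _ _).of_eq (by rw [Sum.update_elim_inl]; simp) (by simp)
  have h18 : Runs (move (Sum.inl AReg.x : QR) (Sum.inr mb) (Sum.inl .s))
      (Sum.elim (file (wbin n) [] [] [] [] [] [] []) { G1 with nC := ([] : List Bool), lb := ([] : List Bool) }.get)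
      (Sum.elim bank0 { G1 with nC := ([] : List Bool), lb := ([] : List Bool), mb := wbin n }.get)
      (6 * (wbin n).length + 2) :=
    (runs_move (by decide) (by decide) (by decide) _ rfl).of_eq
      (by rw [Sum.update_elim_inl, Sum.update_elim_inr]; simp [hG1, hmb]) (by simp)
  have efin : ({ G1 with nC := ([] : List Bool), lb := ([] : List Bool), mb := wbin n } : QF) =
      { G with tU := List.replicate (16 * (n + 2).size) true, mb := wbin n } := by
    rw [hG1]; cases G; simp only at hnC hlb; simp [hnC, hlb]
  replace h18 := h18.congr (congrArg (Sum.elim _) (congrArg QF.get efin))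
  refine (h1.seq (h2.seq (h3.seq (h4.seq (h5.seq (h6.seq (h7.seq (h8.seq (h9.seq (h10.seq (h11.seq (h12.seq
    (h13.seq (h14.seq (h15.seq (h16.seq (h17.seq h18))))))))))))))))).of_eq rfl ?_
  rw [hNlen, helen]
  nlinarith [hub, hL, hsm, hwb, hx1len, hx2len]

/-- Phase B2: `mU := 1^{32 n L} = 1^m`, by pushing `1^{2 t}` once per bit of a copy of `nU`.
[folklore] -/
def phaseB2 : Com QR :=
  copy (Sum.inr nU) (Sum.inr nC) (Sum.inl .s) (Sum.inl .t) ;;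
    loop (Sum.inr nC)
      (copy (Sum.inr tU) (Sum.inl .x) (Sum.inl .s) (Sum.inl .t) ;; fillLoop .x mU true 2)
      (copy (Sum.inr tU) (Sum.inl .x) (Sum.inl .s) (Sum.inl .t) ;; fillLoop .x mU true 2)

/-- **Simulation of phase B2.** [folklore] -/
theorem runs_phaseB2 (G : QF) (n t : ℕ) (hnU : G.nU = List.replicate n true) (hnC : G.nC = [])
    (htU : G.tU = List.replicate t true) (hmU : G.mU = []) :
    Runs phaseB2 (Sum.elim bank0 G.get)
      (Sum.elim bank0 { G with mU := List.replicate (2 * t * n) true }.get)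
      ((14 * t + 8) * n + 10 * n + 4) := by
  set N := List.replicate n true with hN
  have hNlen : N.length = n := by simp [hN]
  have h1 : Runs (copy (Sum.inr nU : QR) (Sum.inr nC) (Sum.inl .s) (Sum.inl .t)) (Sum.elim bank0 G.get)
      (Sum.elim bank0 { G with nC := N }.get) (10 * N.length + 3) :=
    (runs_copy (by decide) (by decide) (by decide) (by decide) (by decide) (by decide) _ rfl rfl).of_eq
      (by rw [Sum.update_elim_inr]; simp [hnU, hnC, hN]) (by simp [hnU, hN])
  let Φ : ℕ → Regs QR := fun j => Sum.elim bank0 { G with mU := List.replicate (2 * t * j) true }.get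
  have hΦ : ∀ j, Φ j (Sum.inr nC) = [] := fun j => by simp [Φ, hnC]
  have hbody : ∀ j, 0 ≤ j → j < 0 + N.length → ∀ w : List Bool,
      Runs (copy (Sum.inr tU : QR) (Sum.inl .x) (Sum.inl .s) (Sum.inl .t) ;; fillLoop .x mU true 2)
        (Function.update (Φ j) (Sum.inr nC) w) (Function.update (Φ (j + 1)) (Sum.inr nC) w) ((10 * t + 3) + ((2 + 2) * t + 1)) := by
    intro j _ _ w
    simp only [Φ]
    rw [Sum.update_elim_inr, QF.update_nC, Sum.update_elim_inr, QF.update_nC]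
    have ha : Runs (copy (Sum.inr tU : QR) (Sum.inl .x) (Sum.inl .s) (Sum.inl .t))
        (Sum.elim bank0 { G with mU := List.replicate (2 * t * j) true, nC := w }.get)
        (Sum.elim (file (List.replicate t true) [] [] [] [] [] [] []) { G with mU := List.replicate (2 * t * j) true, nC := w }.get)
        (10 * t + 3) :=
      (runs_copy (by decide) (by decide) (by decide) (by decide) (by decide) (by decide) _ rfl rfl).of_eq
        (by rw [Sum.update_elim_inl]; simp [htU]) (by simp [htU])
    have hb : Runs (fillLoop .x mU true 2 : Com QR)
        (Sum.elim (file (List.replicate t true) [] [] [] [] [] [] []) { G with mU := List.replicate (2 * t * j) true, nC := w }.get)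
        (Sum.elim bank0 { G with mU := List.replicate (2 * t * (j + 1)) true, nC := w }.get)
        ((2 + 2) * t + 1) := by
      have e2 : List.replicate (2 * t * (j + 1)) true =
          List.replicate (2 * (List.replicate t true).length) true ++ List.replicate (2 * t * j) true := by
        rw [List.length_replicate, List.replicate_append_replicate]; congr 1; ring
      rw [e2]
      refine (runs_fillLoop .x mU true 2 (List.replicate t true) _ _ rfl).of_eq ?_ (by simp)
      simp only [update_file_x, QF.update_mU, QF.get_mU]
    exact ha.seq hb
  have hloop := runs_indexLoop (c := (Sum.inr nC : QR)) Φ ((10 * t + 3) + ((2 + 2) * t + 1)) hΦ N 0 hbody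
  have hstart : Function.update (Φ 0) (Sum.inr nC) N = Sum.elim bank0 { G with nC := N }.get := by
    simp only [Φ]; rw [Sum.update_elim_inr, QF.update_nC]
    congr 1; cases G; simp only at hmU; simp [hmU]
  rw [hstart, Nat.zero_add, hNlen] at hloop
  refine (h1.seq hloop).of_eq rfl ?_
  rw [hNlen]; ring_nf; omega

end PhaseB


/-! ### Phase C: splitting the input into matrix bits, vector bits and padding -/

section PhaseC
open Q

/-- The reading state: `c` input bits consumed, kept reversed in the bank register `s`.
[folklore] -/
def rdSt (z : List Bool) (G : QF) (c : ℕ) : Regs QR :=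
  Sum.elim (file [] [] [] (z.take c).reverse [] [] [] []) { G with inp := z.drop c }.get

/-- One chunk: `tC := tU`, then read `|tU|` bits. [folklore] -/
def readChunk : Com QR :=
  copy (Sum.inr tU) (Sum.inr tC) (Sum.inl .t) (Sum.inl .u) ;; readLoop inp tC

/-- **Simulation of `readChunk`.** [folklore] -/
theorem runs_readChunk (z : List Bool) (G : QF) (t c : ℕ) (htU : G.tU = List.replicate t true)
    (htC : G.tC = []) :
    Runs readChunk (rdSt z G c) (rdSt z G (c + t)) ((10 * t + 3) + (5 * t + 1)) := by
  have h1 : Runs (copy (Sum.inr tU : QR) (Sum.inr tC) (Sum.inl .t) (Sum.inl .u)) (rdSt z G c)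
      (Sum.elim (file [] [] [] (z.take c).reverse [] [] [] []) { G with inp := z.drop c, tC := List.replicate t true }.get)
      (10 * t + 3) :=
    (runs_copy (by decide) (by decide) (by decide) (by decide) (by decide) (by decide) _ rfl rfl).of_eq
      (by rw [rdSt, Sum.update_elim_inr]; simp [htU, htC]) (by simp [rdSt, htU])
  have h2 := runs_readLoop (κ := Q) (h := inp) (c := tC) (by decide) (List.replicate t true) (z.drop c)
    (file [] [] [] (z.take c).reverse [] [] [] [])
    ({ G with inp := z.drop c, tC := List.replicate t true } : QF).get (by simp) (by simp)
  refine (h1.seq (h2.of_eq ?_ (by simp))).of_eq rfl le_rfl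
  rw [rdSt, QF.update_inp, QF.update_tC, update_file_s]
  simp only [List.length_replicate, file_s, List.drop_drop, ← List.reverse_append]
  rw [show z.take c ++ List.take t (List.drop c z) = z.take (c + t) by rw [List.take_add]]
  congr 1; cases G; simp only at htC; simp [htC]

/-- One row of chunks: `mC := mU`, then `|mU|` chunks. [folklore] -/
def readRow : Com QR :=
  copy (Sum.inr mU) (Sum.inr mC) (Sum.inl .t) (Sum.inl .u) ;; loop (Sum.inr mC) readChunk readChunk

/-- **Simulation of `readRow`.** [folklore] -/
theorem runs_readRow (z : List Bool) (G : QF) (m t c : ℕ) (htU : G.tU = List.replicate t true)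
    (htC : G.tC = []) (hmU : G.mU = List.replicate m true) (hmC : G.mC = []) :
    Runs readRow (rdSt z G c) (rdSt z G (c + m * t)) ((10 * m + 3) + ((15 * t + 6) * m + 1)) := by
  set M := List.replicate m true with hM
  have hMlen : M.length = m := by simp [hM]
  have h1 : Runs (copy (Sum.inr mU : QR) (Sum.inr mC) (Sum.inl .t) (Sum.inl .u)) (rdSt z G c)
      (rdSt z { G with mC := M } c) (10 * m + 3) :=
    (runs_copy (by decide) (by decide) (by decide) (by decide) (by decide) (by decide) _ rfl rfl).of_eq
      (by rw [rdSt, rdSt, Sum.update_elim_inr]; simp [hmU, hmC, hM]) (by simp [rdSt, hmU, hMlen])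
  let Φ : ℕ → Regs QR := fun j => rdSt z G (c + j * t)
  have hΦ : ∀ j, Φ j (Sum.inr mC) = [] := fun j => by simp [Φ, rdSt, hmC]
  have hbody : ∀ j, 0 ≤ j → j < 0 + M.length → ∀ w : List Bool,
      Runs readChunk (Function.update (Φ j) (Sum.inr mC) w) (Function.update (Φ (j + 1)) (Sum.inr mC) w)
        ((10 * t + 3) + (5 * t + 1)) := by
    intro j _ _ w
    have e1 : ∀ j, Function.update (Φ j) (Sum.inr mC) w = rdSt z { G with mC := w } (c + j * t) := fun j => by
      simp only [Φ, rdSt]; rw [Sum.update_elim_inr, QF.update_mC]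
    rw [e1, e1, show c + (j + 1) * t = c + j * t + t by ring]
    exact runs_readChunk z { G with mC := w } t (c + j * t) htU htC
  have hloop := runs_indexLoop (c := (Sum.inr mC : QR)) Φ ((10 * t + 3) + (5 * t + 1)) hΦ M 0 hbody
  have hstart : Function.update (Φ 0) (Sum.inr mC) M = rdSt z { G with mC := M } c := by
    simp only [Φ, rdSt]; rw [Sum.update_elim_inr, QF.update_mC]; simp
  rw [hstart, Nat.zero_add, hMlen] at hloop
  refine (h1.seq hloop).of_eq rfl ?_
  nlinarith

/-- Phase C1: read the `n m t` matrix bits (row by row, chunk by chunk) into `s`, then pour them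
(restoring their order) into `hb`. [folklore] -/
def phaseC1 : Com QR :=
  copy (Sum.inr nU) (Sum.inr nC) (Sum.inl .t) (Sum.inl .u) ;; loop (Sum.inr nC) readRow readRow ;;
    pour (Sum.inl .s) (Sum.inr hb)

/-- **Simulation of phase C1.** [folklore] -/
theorem runs_phaseC1 (z : List Bool) (G : QF) (n m t : ℕ) (hinp : G.inp = z) (hnU : G.nU = List.replicate n true)
    (hnC : G.nC = []) (htU : G.tU = List.replicate t true) (htC : G.tC = [])
    (hmU : G.mU = List.replicate m true) (hmC : G.mC = []) (hhb : G.hb = []) :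
    Runs phaseC1 (Sum.elim bank0 G.get)
      (Sum.elim bank0 { G with inp := z.drop (n * m * t), hb := z.take (n * m * t) }.get)
      ((10 * n + 3) + (((10 * m + 3) + ((15 * t + 6) * m + 1) + 2) * n + 1) + (3 * (n * m * t) + 1)) := by
  set N := List.replicate n true with hN
  have hNlen : N.length = n := by simp [hN]
  have hG0 : Sum.elim bank0 G.get = rdSt z G 0 := by
    rw [rdSt]; simp only [List.take_zero, List.reverse_nil, List.drop_zero]
    congr 1; cases G; simp only at hinp; simp [hinp]
  have h1 : Runs (copy (Sum.inr nU : QR) (Sum.inr nC) (Sum.inl .t) (Sum.inl .u)) (rdSt z G 0)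
      (rdSt z { G with nC := N } 0) (10 * n + 3) :=
    (runs_copy (by decide) (by decide) (by decide) (by decide) (by decide) (by decide) _ rfl rfl).of_eq
      (by rw [rdSt, rdSt, Sum.update_elim_inr]; simp [hnU, hnC, hN]) (by simp [rdSt, hnU, hNlen])
  let Φ : ℕ → Regs QR := fun i => rdSt z G (i * (m * t))
  have hΦ : ∀ i, Φ i (Sum.inr nC) = [] := fun i => by simp [Φ, rdSt, hnC]
  have hbody : ∀ i, 0 ≤ i → i < 0 + N.length → ∀ w : List Bool,
      Runs readRow (Function.update (Φ i) (Sum.inr nC) w) (Function.update (Φ (i + 1)) (Sum.inr nC) w)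
        ((10 * m + 3) + ((15 * t + 6) * m + 1)) := by
    intro i _ _ w
    have e1 : ∀ i, Function.update (Φ i) (Sum.inr nC) w = rdSt z { G with nC := w } (i * (m * t)) := fun i => by
      simp only [Φ, rdSt]; rw [Sum.update_elim_inr, QF.update_nC]
    rw [e1, e1, show (i + 1) * (m * t) = i * (m * t) + m * t by ring]
    exact runs_readRow z { G with nC := w } m t (i * (m * t)) htU htC hmU hmC
  have hloop := runs_indexLoop (c := (Sum.inr nC : QR)) Φ ((10 * m + 3) + ((15 * t + 6) * m + 1)) hΦ N 0 hbody
  have hstart : Function.update (Φ 0) (Sum.inr nC) N = rdSt z { G with nC := N } 0 := by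
    simp only [Φ, rdSt]; rw [Sum.update_elim_inr, QF.update_nC]; simp
  rw [hstart, Nat.zero_add, hNlen] at hloop
  have h3 : Runs (pour (Sum.inl AReg.s : QR) (Sum.inr hb)) (rdSt z G (n * (m * t)))
      (Sum.elim bank0 { G with inp := z.drop (n * m * t), hb := z.take (n * m * t) }.get)
      (3 * (n * m * t) + 1) := by
    refine (runs_pour (by decide) _).of_eq ?_ ?_
    · rw [rdSt, Sum.update_elim_inl, Sum.update_elim_inr, update_file_s, QF.update_hb]
      simp only [Sum.elim_inl, Sum.elim_inr, file_s, QF.get_hb, List.reverse_reverse, hhb, List.append_nil,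
        Nat.mul_assoc]
    · simp only [rdSt, Sum.elim_inl, file_s, List.length_reverse, List.length_take, Nat.mul_assoc]
      have := Nat.min_le_left (n * (m * t)) z.length
      omega
  rw [hG0]
  exact (h1.seq (hloop.seq h3)).of_eq rfl (le_of_eq (by ring))

/-- Phase C2: read the `m` bits of `x` into `xv`; the rest of the input is the padding. [folklore] -/
def phaseC2 : Com QR :=
  copy (Sum.inr mU) (Sum.inr mC) (Sum.inl .t) (Sum.inl .u) ;; readLoop inp mC ;; pour (Sum.inl .s) (Sum.inr xv)

/-- **Simulation of phase C2.** [folklore] -/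
theorem runs_phaseC2 (w : List Bool) (G : QF) (m : ℕ) (hinp : G.inp = w) (hmU : G.mU = List.replicate m true)
    (hmC : G.mC = []) (hxv : G.xv = []) :
    Runs phaseC2 (Sum.elim bank0 G.get)
      (Sum.elim bank0 { G with inp := w.drop m, xv := w.take m }.get)
      ((10 * m + 3) + (5 * m + 1) + (3 * m + 1)) := by
  set M := List.replicate m true with hM
  have hMlen : M.length = m := by simp [hM]
  have h1 : Runs (copy (Sum.inr mU : QR) (Sum.inr mC) (Sum.inl .t) (Sum.inl .u)) (Sum.elim bank0 G.get)
      (Sum.elim bank0 { G with mC := M }.get) (10 * m + 3) :=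
    (runs_copy (by decide) (by decide) (by decide) (by decide) (by decide) (by decide) _ rfl rfl).of_eq
      (by rw [Sum.update_elim_inr]; simp [hmU, hmC, hM]) (by simp [hmU, hMlen])
  have h2 := runs_readLoop (κ := Q) (h := inp) (c := mC) (by decide) M w bank0
    ({ G with mC := M } : QF).get (by simp) (by simp [hinp])
  rw [hMlen] at h2
  have h2' : Runs (readLoop inp mC : Com QR) (Sum.elim bank0 { G with mC := M }.get)
      (Sum.elim (file [] [] [] (w.take m).reverse [] [] [] []) { G with inp := w.drop m, mC := ([] : List Bool) }.get)
      (5 * m + 1) := by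
    refine h2.of_eq ?_ le_rfl
    rw [QF.update_inp, QF.update_mC, update_file_s]; simp
  have h3 : Runs (pour (Sum.inl AReg.s : QR) (Sum.inr xv))
      (Sum.elim (file [] [] [] (w.take m).reverse [] [] [] []) { G with inp := w.drop m, mC := ([] : List Bool) }.get)
      (Sum.elim bank0 { G with inp := w.drop m, xv := w.take m }.get) (3 * m + 1) := by
    refine (runs_pour (by decide) _).of_eq ?_ ?_
    · rw [Sum.update_elim_inl, Sum.update_elim_inr, update_file_s, QF.update_xv]
      simp only [Sum.elim_inl, Sum.elim_inr, file_s, QF.get_xv, List.reverse_reverse, hxv, List.append_nil]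
      congr 1; cases G; simp only at hmC; simp [hmC]
    · simp only [Sum.elim_inl, file_s, List.length_reverse, List.length_take]
      have := Nat.min_le_left m w.length
      omega
  exact (h1.seq (h2'.seq h3)).of_eq rfl (le_of_eq (by ring))

end PhaseC


/-! ### Phase D: the headers of the matrix code and of the residue code -/

section PhaseD
open Q

/-- Push the separator `sep a` on the buffer `o` (which holds the reverse of the emitted
string). [folklore] -/
def pushSep (o : Q) (a : ℕ) : Com QR := pushN (Sum.inr o) false a ;; pushN (Sum.inr o) true a

/-- Effect of `pushSep`: `o := reverse (sep a) ++ o`. [folklore] -/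
theorem runs_pushSep (o : Q) (a : ℕ) (F : Regs AReg) (P : Regs Q) :
    Runs (pushSep o a) (Sum.elim F P) (Sum.elim F (Function.update P o ((sep a).reverse ++ P o))) (a + a) := by
  refine ((runs_pushN (Sum.inr o : QR) false a _).seq (runs_pushN (Sum.inr o : QR) true a _)).of_eq ?_ le_rfl
  rw [Sum.update_elim_inr, Sum.update_elim_inr]
  simp only [Function.update_idem, Function.update_self, Sum.elim_inr, sep, List.reverse_append,
    List.reverse_replicate, List.append_assoc]

/-- `pushSep` on a record state. [folklore] -/
theorem runs_pushSep_o1 (a : ℕ) (F : Regs AReg) (G : QF) :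
    Runs (pushSep o1 a) (Sum.elim F G.get) (Sum.elim F { G with o1 := (sep a).reverse ++ G.o1 }.get) (a + a) :=
  (runs_pushSep o1 a F G.get).of_eq (by rw [QF.get_o1, QF.update_o1]) le_rfl

/-- `pushSep` on a record state. [folklore] -/
theorem runs_pushSep_o2 (a : ℕ) (F : Regs AReg) (G : QF) :
    Runs (pushSep o2 a) (Sum.elim F G.get) (Sum.elim F { G with o2 := (sep a).reverse ++ G.o2 }.get) (a + a) :=
  (runs_pushSep o2 a F G.get).of_eq (by rw [QF.get_o2, QF.update_o2]) le_rfl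

/-- Header piece 1: `quad (encodeNat n) ++ sep 2`. [folklore] -/
def hdr1 (n : ℕ) : List Bool := repBits 4 (encodeNat n) ++ sep 2
/-- Header piece 2: `quad (encodeNat m) ++ sep 2`. [folklore] -/
def hdr2 (n : ℕ) : List Bool := repBits 4 (encodeNat (width n)) ++ sep 2
/-- Header piece 3: `quad (encodeNat q) ++ sep 2 = 0^{4t} 1^4 ++ sep 2`. [folklore] -/
def hdr3 (t : ℕ) : List Bool := List.replicate (4 * t) false ++ List.replicate 4 true ++ sep 2
/-- Header piece 4: `quad (1^n) ++ sep 2`. [folklore] -/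
def hdr4 (n : ℕ) : List Bool := List.replicate (4 * n) true ++ sep 2

/-- Phase D1: emit `quad (encodeNat n) ++ sep 2` on `o1` (count `nU`, normalise, emit at level 4).
[folklore] -/
def phaseD1 : Com QR :=
  copy (Sum.inr nU) (Sum.inr nC) (Sum.inl .s) (Sum.inl .t) ;; push (Sum.inl .y) true ;; mulAddLoop nC ;;
    clear (Sum.inl .y) ;; bk normalize ;; emitLoop .x o1 4 ;; pushSep o1 2

/-- **Simulation of phase D1.** [folklore] -/
theorem runs_phaseD1 (G : QF) (n : ℕ) :
    Runs phaseD1 (Sum.elim bank0 { G with nU := List.replicate n true, nC := [] }.get)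
      (Sum.elim bank0 { G with nU := List.replicate n true, nC := [], o1 := (hdr1 n).reverse ++ G.o1 }.get)
      (100 * (n + 2) ^ 2) := by
  have hub := length_ubin_le n
  have hNlen : (List.replicate n true).length = n := by simp
  have h1 : Runs (copy (Sum.inr nU : QR) (Sum.inr nC) (Sum.inl .s) (Sum.inl .t))
      (Sum.elim bank0 { G with nU := List.replicate n true, nC := [] }.get)
      (Sum.elim bank0 { G with nU := List.replicate n true, nC := List.replicate n true }.get) (10 * n + 3) :=
    (runs_copy (by decide) (by decide) (by decide) (by decide) (by decide) (by decide) _ rfl rfl).of_eq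
      (by rw [Sum.update_elim_inr]; simp) (by simp)
  have h2 : Runs (push (Sum.inl AReg.y : QR) true)
      (Sum.elim bank0 { G with nU := List.replicate n true, nC := List.replicate n true }.get)
      (Sum.elim (file [] [true] [] [] [] [] [] []) { G with nU := List.replicate n true, nC := List.replicate n true }.get) 1 :=
    Runs.push' (by rw [Sum.update_elim_inl]; simp)
  have h3 : Runs (mulAddLoop nC : Com QR)
      (Sum.elim (file [] [true] [] [] [] [] [] []) { G with nU := List.replicate n true, nC := List.replicate n true }.get)
      (Sum.elim (file (ubin n) [true] [] [] [] [] [] []) { G with nU := List.replicate n true, nC := [] }.get)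
      ((26 * (1 + n) + 14) * n + 1) :=
    (runs_mulAddLoop nC (List.replicate n true) [] [true] [] [] [] 1 (by simp) (by simp) _ (by simp)).of_eq
      (by rw [QF.update_nC, hNlen]; rfl) (by rw [hNlen])
  have h4 : Runs (clear (Sum.inl AReg.y : QR))
      (Sum.elim (file (ubin n) [true] [] [] [] [] [] []) { G with nU := List.replicate n true, nC := [] }.get)
      (Sum.elim (file (ubin n) [] [] [] [] [] [] []) { G with nU := List.replicate n true, nC := [] }.get) 3 :=
    (runs_clear _ _).of_eq (by rw [Sum.update_elim_inl]; simp) (by simp)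
  have hval : norm (ubin n) = encodeNat n := by rw [norm_eq_encodeNat, bitsToNat_ubin]
  have helen : (encodeNat n).length ≤ (ubin n).length := by rw [← hval]; exact length_norm_le _
  have h5 : Runs (bk normalize) (Sum.elim (file (ubin n) [] [] [] [] [] [] []) { G with nU := List.replicate n true, nC := [] }.get)
      (Sum.elim (file (encodeNat n) [] [] [] [] [] [] []) { G with nU := List.replicate n true, nC := [] }.get) (9 * (ubin n).length + 5) :=
    ((runs_normalize (ubin n) [] [] [] [] []).inl _).of_eq (by rw [hval]) le_rfl
  have h6 : Runs (emitLoop .x o1 4 : Com QR)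
      (Sum.elim (file (encodeNat n) [] [] [] [] [] [] []) { G with nU := List.replicate n true, nC := [] }.get)
      (Sum.elim bank0 { G with nU := List.replicate n true, nC := [], o1 := repBits 4 (encodeNat n).reverse ++ G.o1 }.get)
      ((4 + 2) * (encodeNat n).length + 1) :=
    (runs_emitLoop .x o1 4 (encodeNat n) _ _ rfl).of_eq (by rw [update_file_x, QF.update_o1, QF.get_o1]) le_rfl
  have h7 := runs_pushSep_o1 2 bank0
    ({ G with nU := List.replicate n true, nC := [], o1 := repBits 4 (encodeNat n).reverse ++ G.o1 } : QF)
  refine (h1.seq (h2.seq (h3.seq (h4.seq (h5.seq (h6.seq h7)))))).of_eq ?_ ?_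
  · simp only [hdr1, List.reverse_append, reverse_repBits, List.append_assoc]
  · nlinarith [hub, helen]

/-- Phase D2: emit `quad (encodeNat m) ++ sep 2` on `o1` (normalise `mb`, emit at level 4).
[folklore] -/
def phaseD2 : Com QR :=
  move (Sum.inr mb) (Sum.inl .x) (Sum.inl .s) ;; bk normalize ;; emitLoop .x o1 4 ;; pushSep o1 2

/-- **Simulation of phase D2.** [folklore] -/
theorem runs_phaseD2 (G : QF) (n : ℕ) :
    Runs phaseD2 (Sum.elim bank0 { G with mb := wbin n }.get)
      (Sum.elim bank0 { G with mb := [], o1 := (hdr2 n).reverse ++ G.o1 }.get) (60 * (n + 4)) := by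
  have hwb := length_wbin_le n
  have h1 : Runs (move (Sum.inr mb : QR) (Sum.inl .x) (Sum.inl .s)) (Sum.elim bank0 { G with mb := wbin n }.get)
      (Sum.elim (file (wbin n) [] [] [] [] [] [] []) { G with mb := [] }.get) (6 * (wbin n).length + 2) :=
    (runs_move (by decide) (by decide) (by decide) _ rfl).of_eq
      (by rw [Sum.update_elim_inr, Sum.update_elim_inl]; simp) (by simp)
  have hval : norm (wbin n) = encodeNat (width n) := by rw [norm_eq_encodeNat, bitsToNat_wbin]
  have helen : (encodeNat (width n)).length ≤ (wbin n).length := by rw [← hval]; exact length_norm_le _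
  have h2 : Runs (bk normalize) (Sum.elim (file (wbin n) [] [] [] [] [] [] []) { G with mb := [] }.get)
      (Sum.elim (file (encodeNat (width n)) [] [] [] [] [] [] []) { G with mb := [] }.get) (9 * (wbin n).length + 5) :=
    ((runs_normalize (wbin n) [] [] [] [] []).inl _).of_eq (by rw [hval]) le_rfl
  have h3 : Runs (emitLoop .x o1 4 : Com QR) (Sum.elim (file (encodeNat (width n)) [] [] [] [] [] [] []) { G with mb := [] }.get)
      (Sum.elim bank0 { G with mb := [], o1 := repBits 4 (encodeNat (width n)).reverse ++ G.o1 }.get)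
      ((4 + 2) * (encodeNat (width n)).length + 1) :=
    (runs_emitLoop .x o1 4 (encodeNat (width n)) _ _ rfl).of_eq (by rw [update_file_x, QF.update_o1, QF.get_o1]) le_rfl
  have h4 := runs_pushSep_o1 2 bank0 ({ G with mb := [], o1 := repBits 4 (encodeNat (width n)).reverse ++ G.o1 } : QF)
  refine (h1.seq (h2.seq (h3.seq h4))).of_eq ?_ ?_
  · simp only [hdr2, List.reverse_append, reverse_repBits, List.append_assoc]
  · nlinarith [hwb, helen]

/-- Phase D3: emit `0^{4t} 1^4 ++ sep 2 = quad (encodeNat 2^t) ++ sep 2` on `o1`. [folklore] -/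
def phaseD3 : Com QR :=
  copy (Sum.inr tU) (Sum.inl .x) (Sum.inl .s) (Sum.inl .t) ;; fillLoop .x o1 false 4 ;;
    pushN (Sum.inr o1) true 4 ;; pushSep o1 2

/-- **Simulation of phase D3.** [folklore] -/
theorem runs_phaseD3 (G : QF) (t : ℕ) :
    Runs phaseD3 (Sum.elim bank0 { G with tU := List.replicate t true }.get)
      (Sum.elim bank0 { G with tU := List.replicate t true, o1 := (hdr3 t).reverse ++ G.o1 }.get)
      (16 * t + 12) := by
  have hTlen : (List.replicate t true).length = t := by simp
  have h1 : Runs (copy (Sum.inr tU : QR) (Sum.inl .x) (Sum.inl .s) (Sum.inl .t)) (Sum.elim bank0 { G with tU := List.replicate t true }.get)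
      (Sum.elim (file (List.replicate t true) [] [] [] [] [] [] []) { G with tU := List.replicate t true }.get) (10 * t + 3) :=
    (runs_copy (by decide) (by decide) (by decide) (by decide) (by decide) (by decide) _ rfl rfl).of_eq
      (by rw [Sum.update_elim_inl]; simp) (by simp)
  have h2 : Runs (fillLoop .x o1 false 4 : Com QR)
      (Sum.elim (file (List.replicate t true) [] [] [] [] [] [] []) { G with tU := List.replicate t true }.get)
      (Sum.elim bank0 { G with tU := List.replicate t true, o1 := List.replicate (4 * t) false ++ G.o1 }.get) ((4 + 2) * t + 1) :=
    (runs_fillLoop .x o1 false 4 (List.replicate t true) _ _ rfl).of_eq (by rw [update_file_x, QF.update_o1, QF.get_o1, hTlen]) (by rw [hTlen])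
  have h3 : Runs (pushN (Sum.inr o1 : QR) true 4)
      (Sum.elim bank0 { G with tU := List.replicate t true, o1 := List.replicate (4 * t) false ++ G.o1 }.get)
      (Sum.elim bank0 { G with tU := List.replicate t true, o1 := List.replicate 4 true ++ (List.replicate (4 * t) false ++ G.o1) }.get) 4 :=
    (runs_pushN _ _ 4 _).of_eq (by rw [Sum.update_elim_inr, Sum.elim_inr, QF.get_o1, QF.update_o1]) le_rfl
  have h4 := runs_pushSep_o1 2 bank0
    ({ G with tU := List.replicate t true, o1 := List.replicate 4 true ++ (List.replicate (4 * t) false ++ G.o1) } : QF)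
  refine (h1.seq (h2.seq (h3.seq h4))).of_eq ?_ (by omega)
  simp only [hdr3, List.reverse_append, List.reverse_replicate, List.append_assoc]

/-- Phase D4: emit `1^{4n} ++ sep 2 = quad (unary n) ++ sep 2` on both buffers. [folklore] -/
def phaseD4 : Com QR :=
  copy (Sum.inr nU) (Sum.inl .x) (Sum.inl .s) (Sum.inl .t) ;; fillLoop .x o1 true 4 ;; pushSep o1 2 ;;
    copy (Sum.inr nU) (Sum.inl .x) (Sum.inl .s) (Sum.inl .t) ;; fillLoop .x o2 true 4 ;; pushSep o2 2

/-- **Simulation of phase D4.** [folklore] -/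
theorem runs_phaseD4 (G : QF) (n : ℕ) :
    Runs phaseD4 (Sum.elim bank0 { G with nU := List.replicate n true }.get)
      (Sum.elim bank0 { G with nU := List.replicate n true, o1 := (hdr4 n).reverse ++ G.o1, o2 := (hdr4 n).reverse ++ G.o2 }.get)
      (32 * n + 16) := by
  have hNlen : (List.replicate n true).length = n := by simp
  have h1 : Runs (copy (Sum.inr nU : QR) (Sum.inl .x) (Sum.inl .s) (Sum.inl .t)) (Sum.elim bank0 { G with nU := List.replicate n true }.get)
      (Sum.elim (file (List.replicate n true) [] [] [] [] [] [] []) { G with nU := List.replicate n true }.get) (10 * n + 3) :=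
    (runs_copy (by decide) (by decide) (by decide) (by decide) (by decide) (by decide) _ rfl rfl).of_eq
      (by rw [Sum.update_elim_inl]; simp) (by simp)
  have h2 : Runs (fillLoop .x o1 true 4 : Com QR)
      (Sum.elim (file (List.replicate n true) [] [] [] [] [] [] []) { G with nU := List.replicate n true }.get)
      (Sum.elim bank0 { G with nU := List.replicate n true, o1 := List.replicate (4 * n) true ++ G.o1 }.get) ((4 + 2) * n + 1) :=
    (runs_fillLoop .x o1 true 4 (List.replicate n true) _ _ rfl).of_eq (by rw [update_file_x, QF.update_o1, QF.get_o1, hNlen]) (by rw [hNlen])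
  have h3 := runs_pushSep_o1 2 bank0 ({ G with nU := List.replicate n true, o1 := List.replicate (4 * n) true ++ G.o1 } : QF)
  have e3 : ({ ({ G with nU := List.replicate n true, o1 := List.replicate (4 * n) true ++ G.o1 } : QF) with
      o1 := (sep 2).reverse ++ (List.replicate (4 * n) true ++ G.o1) } : QF) =
      { G with nU := List.replicate n true, o1 := (hdr4 n).reverse ++ G.o1 } := by
    simp only [hdr4, List.reverse_append, List.reverse_replicate, List.append_assoc]
  rw [e3] at h3
  have h4 : Runs (copy (Sum.inr nU : QR) (Sum.inl .x) (Sum.inl .s) (Sum.inl .t))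
      (Sum.elim bank0 { G with nU := List.replicate n true, o1 := (hdr4 n).reverse ++ G.o1 }.get)
      (Sum.elim (file (List.replicate n true) [] [] [] [] [] [] []) { G with nU := List.replicate n true, o1 := (hdr4 n).reverse ++ G.o1 }.get)
      (10 * n + 3) :=
    (runs_copy (by decide) (by decide) (by decide) (by decide) (by decide) (by decide) _ rfl rfl).of_eq
      (by rw [Sum.update_elim_inl]; simp) (by simp)
  have h5 : Runs (fillLoop .x o2 true 4 : Com QR)
      (Sum.elim (file (List.replicate n true) [] [] [] [] [] [] []) { G with nU := List.replicate n true, o1 := (hdr4 n).reverse ++ G.o1 }.get)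
      (Sum.elim bank0 { G with nU := List.replicate n true, o1 := (hdr4 n).reverse ++ G.o1, o2 := List.replicate (4 * n) true ++ G.o2 }.get)
      ((4 + 2) * n + 1) :=
    (runs_fillLoop .x o2 true 4 (List.replicate n true) _ _ rfl).of_eq (by rw [update_file_x, QF.update_o2, QF.get_o2, hNlen]) (by rw [hNlen])
  have h6 := runs_pushSep_o2 2 bank0
    ({ G with nU := List.replicate n true, o1 := (hdr4 n).reverse ++ G.o1, o2 := List.replicate (4 * n) true ++ G.o2 } : QF)
  refine (h1.seq (h2.seq (h3.seq (h4.seq (h5.seq h6))))).of_eq ?_ (by omega)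
  simp only [hdr4, List.reverse_append, List.reverse_replicate, List.append_assoc]

/-- **Phase D**: the four header pieces. [folklore] -/
def phaseD : Com QR := phaseD1 ;; phaseD2 ;; phaseD3 ;; phaseD4

/-- The header of the matrix buffer. [folklore] -/
def hdrM (n t : ℕ) : List Bool := hdr1 n ++ hdr2 n ++ hdr3 t ++ hdr4 n

/-- **Simulation of phase D.** [folklore] -/
theorem runs_phaseD (G : QF) (n t : ℕ) :
    Runs phaseD (Sum.elim bank0 { G with nU := List.replicate n true, nC := [], mb := wbin n, tU := List.replicate t true }.get)
      (Sum.elim bank0 { G with nU := List.replicate n true, nC := [], mb := [], tU := List.replicate t true, o1 := (hdrM n t).reverse ++ G.o1, o2 := (hdr4 n).reverse ++ G.o2 }.get)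
      (100 * (n + 2) ^ 2 + 60 * (n + 4) + (16 * t + 12) + (32 * n + 16)) := by
  have h1 := runs_phaseD1 { G with mb := wbin n, tU := List.replicate t true } n
  have h2 := runs_phaseD2 { G with nU := List.replicate n true, nC := [], tU := List.replicate t true, o1 := (hdr1 n).reverse ++ G.o1 } n
  have h3 := runs_phaseD3 { G with nU := List.replicate n true, nC := [], mb := [], o1 := (hdr2 n).reverse ++ ((hdr1 n).reverse ++ G.o1) } t
  have h4 := runs_phaseD4 { G with nC := [], mb := [], tU := List.replicate t true, o1 := (hdr3 t).reverse ++ ((hdr2 n).reverse ++ ((hdr1 n).reverse ++ G.o1)) } n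
  refine (h1.seq (h2.seq (h3.seq h4))).of_eq ?_ (le_of_eq (by ring))
  simp only [hdrM, List.reverse_append, List.append_assoc]

end PhaseD


/-! ### Phase E: the rows — entries into the matrix buffer, residues into the residue buffer -/

section PhaseE
open Q

/-- The `j`-th chunk of `t` bits of a row-rest `R`. [folklore] -/
def chk (t : ℕ) (R : List Bool) (j : ℕ) : List Bool := (R.drop (j * t)).take t

/-- Its canonical numeral. [folklore] -/
def ent (t : ℕ) (R : List Bool) (j : ℕ) : List Bool := norm (chk t R j)

/-- Chunks have at most `t` bits. [folklore] -/
theorem length_chk_le (t : ℕ) (R : List Bool) (j : ℕ) : (chk t R j).length ≤ t := by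
  simp [chk]

/-- Entry numerals have at most `t` bits. [folklore] -/
theorem length_ent_le (t : ℕ) (R : List Bool) (j : ℕ) : (ent t R j).length ≤ t :=
  (length_norm_le _).trans (length_chk_le t R j)

/-- The accumulator after `j` entries of a row: add the entry iff the corresponding bit of `x` is
set. [folklore] -/
def accL (t : ℕ) (R X : List Bool) : ℕ → List Bool
  | 0 => []
  | j + 1 => if X.getD j false then addRes (ent t R j) (accL t R X j) else accL t R X j

/-- The accumulator grows by at most one bit per entry. [folklore] -/
theorem length_accL_le (t : ℕ) (R X : List Bool) : ∀ j, (accL t R X j).length ≤ t + j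
  | 0 => by simp [accL]
  | j + 1 => by
    rw [accL]
    have ih := length_accL_le t R X j
    split_ifs
    · have := length_addRes_le_max (ent t R j) (accL t R X j)
      have : max (ent t R j).length (accL t R X j).length ≤ t + j := max_le ((length_ent_le t R j).trans (by omega)) ih
      omega
    · omega

/-- The emitted code of the entries `< j` of a row (doubling level 8, separators at level 4).
[folklore] -/
def entsOut (t : ℕ) (R : List Bool) : ℕ → List Bool
  | 0 => []
  | j + 1 => entsOut t R j ++ (repBits 8 (ent t R j) ++ sep 4)

/-- **One entry**: read the next chunk, normalise it, emit it, and conditionally add it to the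
accumulator. [folklore] -/
def entryStep : Com QR :=
  copy (Sum.inr tU) (Sum.inr tC) (Sum.inl .s) (Sum.inl .t) ;; readLoop hb tC ;;
    pour (Sum.inl .s) (Sum.inl .x) ;; bk normalize ;;
    copy (Sum.inl .x) (Sum.inl .z) (Sum.inl .s) (Sum.inl .t) ;; emitLoop .z o1 8 ;; pushSep o1 4 ;;
    pop (Sum.inr xc)
      (move (Sum.inr acc) (Sum.inl .y) (Sum.inl .s) ;; bk add ;; clear (Sum.inl .y) ;; move (Sum.inl .x) (Sum.inr acc) (Sum.inl .s))
      (clear (Sum.inl .x)) (clear (Sum.inl .x))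

/-- The invariant states of the entry loop of a row (rest `R`, vector bits `X`). [folklore] -/
def stE (G : QF) (t : ℕ) (R X : List Bool) (j : ℕ) : QF :=
  { G with tU := List.replicate t true, hb := R.drop (j * t), xc := X.drop j, acc := accL t R X j, o1 := (entsOut t R j).reverse ++ G.o1, mC := [], tC := [] }

/-- **Simulation of `entryStep`.** [folklore] -/
theorem runs_entryStep (G : QF) (t : ℕ) (R X w : List Bool) (j : ℕ) :
    Runs entryStep (Sum.elim bank0 { stE G t R X j with mC := w }.get)
      (Sum.elim bank0 { stE G t R X (j + 1) with mC := w }.get) (120 * (t + 1) + 30 * j) := by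
  have hTlen : (List.replicate t true).length = t := by simp
  have hacc := length_accL_le t R X j
  have hent := length_ent_le t R j
  have hchk := length_chk_le t R j
  -- read the chunk
  have h1 : Runs (copy (Sum.inr tU : QR) (Sum.inr tC) (Sum.inl .s) (Sum.inl .t))
      (Sum.elim bank0 { stE G t R X j with mC := w }.get)
      (Sum.elim bank0 { stE G t R X j with mC := w, tC := List.replicate t true }.get) (10 * t + 3) :=
    (runs_copy (by decide) (by decide) (by decide) (by decide) (by decide) (by decide) _ rfl rfl).of_eq
      (by rw [Sum.update_elim_inr]; simp [stE]) (by simp [stE])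
  have h2 : Runs (readLoop hb tC : Com QR)
      (Sum.elim bank0 { stE G t R X j with mC := w, tC := List.replicate t true }.get)
      (Sum.elim (file [] [] [] (chk t R j).reverse [] [] [] []) { stE G t R X j with mC := w, tC := [], hb := R.drop ((j + 1) * t) }.get)
      (5 * t + 1) := by
    refine (runs_readLoop (κ := Q) (h := hb) (c := tC) (by decide) (List.replicate t true) (R.drop (j * t)) bank0 _
      (by simp) (by simp [stE])).of_eq ?_ (by rw [hTlen])
    rw [QF.update_hb, QF.update_tC, update_file_s, hTlen]
    simp only [file_s, List.append_nil, chk, List.drop_drop]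
    rw [show j * t + t = (j + 1) * t by ring]
  -- x := chunk, normalised
  have h3 : Runs (pour (Sum.inl AReg.s : QR) (Sum.inl .x))
      (Sum.elim (file [] [] [] (chk t R j).reverse [] [] [] []) { stE G t R X j with mC := w, tC := [], hb := R.drop ((j + 1) * t) }.get)
      (Sum.elim (file (chk t R j) [] [] [] [] [] [] []) { stE G t R X j with mC := w, tC := [], hb := R.drop ((j + 1) * t) }.get)
      (3 * (chk t R j).length + 1) :=
    (runs_pour (by decide) _).of_eq (by rw [Sum.update_elim_inl, Sum.update_elim_inl]; simp) (by simp)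
  have h4 : Runs (bk normalize)
      (Sum.elim (file (chk t R j) [] [] [] [] [] [] []) { stE G t R X j with mC := w, tC := [], hb := R.drop ((j + 1) * t) }.get)
      (Sum.elim (file (ent t R j) [] [] [] [] [] [] []) { stE G t R X j with mC := w, tC := [], hb := R.drop ((j + 1) * t) }.get)
      (9 * (chk t R j).length + 5) :=
    ((runs_normalize (chk t R j) [] [] [] [] []).inl _).of_eq rfl le_rfl
  -- emit the entry
  have h5 : Runs (copy (Sum.inl AReg.x : QR) (Sum.inl .z) (Sum.inl .s) (Sum.inl .t))
      (Sum.elim (file (ent t R j) [] [] [] [] [] [] []) { stE G t R X j with mC := w, tC := [], hb := R.drop ((j + 1) * t) }.get)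
      (Sum.elim (file (ent t R j) [] (ent t R j) [] [] [] [] []) { stE G t R X j with mC := w, tC := [], hb := R.drop ((j + 1) * t) }.get)
      (10 * (ent t R j).length + 3) :=
    (runs_copy (by decide) (by decide) (by decide) (by decide) (by decide) (by decide) _ rfl rfl).of_eq
      (by rw [Sum.update_elim_inl]; simp) (by simp)
  have h6 : Runs (emitLoop .z o1 8 : Com QR)
      (Sum.elim (file (ent t R j) [] (ent t R j) [] [] [] [] []) { stE G t R X j with mC := w, tC := [], hb := R.drop ((j + 1) * t) }.get)
      (Sum.elim (file (ent t R j) [] [] [] [] [] [] []) { stE G t R X j with mC := w, tC := [], hb := R.drop ((j + 1) * t), o1 := repBits 8 (ent t R j).reverse ++ ((entsOut t R j).reverse ++ G.o1) }.get)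
      ((8 + 2) * (ent t R j).length + 1) :=
    (runs_emitLoop .z o1 8 (ent t R j) _ _ rfl).of_eq (by rw [update_file_z, QF.update_o1, QF.get_o1]; rfl) le_rfl
  have h7 := runs_pushSep_o1 4 (file (ent t R j) [] [] [] [] [] [] [])
    ({ stE G t R X j with mC := w, tC := [], hb := R.drop ((j + 1) * t), o1 := repBits 8 (ent t R j).reverse ++ ((entsOut t R j).reverse ++ G.o1) } : QF)
  have e7 : ({ ({ stE G t R X j with mC := w, tC := [], hb := R.drop ((j + 1) * t), o1 := repBits 8 (ent t R j).reverse ++ ((entsOut t R j).reverse ++ G.o1) } : QF) with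
      o1 := (sep 4).reverse ++ (repBits 8 (ent t R j).reverse ++ ((entsOut t R j).reverse ++ G.o1)) } : QF) =
      { stE G t R X j with mC := w, tC := [], hb := R.drop ((j + 1) * t), o1 := (entsOut t R (j + 1)).reverse ++ G.o1 } := by
    simp only [entsOut, List.reverse_append, reverse_repBits, List.append_assoc]
  rw [e7] at h7
  -- conditional accumulation
  set S : QF := { stE G t R X j with mC := w, tC := [], hb := R.drop ((j + 1) * t), o1 := (entsOut t R (j + 1)).reverse ++ G.o1 } with hS
  have h8 : Runs (pop (Sum.inr xc : QR)
        (move (Sum.inr acc) (Sum.inl .y) (Sum.inl .s) ;; bk add ;; clear (Sum.inl .y) ;; move (Sum.inl .x) (Sum.inr acc) (Sum.inl .s))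
        (clear (Sum.inl .x)) (clear (Sum.inl .x)))
      (Sum.elim (file (ent t R j) [] [] [] [] [] [] []) S.get)
      (Sum.elim bank0 { stE G t R X (j + 1) with mC := w }.get)
      ((6 * (t + j) + 2) + (13 * (t + (t + j)) + 12) + (2 * (t + j) + 1) + (6 * (t + j + 1) + 2) + 2) := by
    have hxc : S.xc = X.drop j := by simp [hS, stE]
    have hpost : ∀ (b : Bool) (xs : List Bool), X.drop j = b :: xs →
        ({ stE G t R X (j + 1) with mC := w } : QF) =
          { S with xc := xs, acc := if b then addRes (ent t R j) (accL t R X j) else accL t R X j } := by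
      intro b xs hd
      have hget : X.getD j false = b := by
        rw [List.getD_eq_getElem?_getD, ← List.head?_drop, hd]; rfl
      have hdrop : X.drop (j + 1) = xs := by rw [← List.drop_drop, hd]; rfl
      simp only [hS, stE, accL, hget, hdrop]
    cases hd : X.drop j with
    | nil =>
      have hget : X.getD j false = false := by
        rw [List.getD_eq_getElem?_getD, ← List.head?_drop, hd]; rfl
      have hdrop : X.drop (j + 1) = [] := by rw [← List.drop_drop, hd]; rfl
      have hk : (Sum.elim (file (ent t R j) [] [] [] [] [] [] []) S.get) (Sum.inr xc) = [] := by simp [hxc, hd]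
      have hc : Runs (clear (Sum.inl AReg.x : QR)) (Sum.elim (file (ent t R j) [] [] [] [] [] [] []) S.get)
          (Sum.elim bank0 S.get) (2 * (ent t R j).length + 1) :=
        (runs_clear _ _).of_eq (by rw [Sum.update_elim_inl, update_file_x]) (by simp)
      refine (Runs.pop_nil _ _ hk hc).of_eq ?_ ?_
      · rw [hS]; simp only [stE, accL]; rw [hget]; simp [hdrop, hd]
      · omega
    | cons b xs =>
      have hk : (Sum.elim (file (ent t R j) [] [] [] [] [] [] []) S.get) (Sum.inr xc) = b :: xs := by simp [hxc, hd]
      have hup : Function.update (Sum.elim (file (ent t R j) [] [] [] [] [] [] []) S.get) (Sum.inr xc) xs =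
          Sum.elim (file (ent t R j) [] [] [] [] [] [] []) { S with xc := xs }.get := by rw [Sum.update_elim_inr, QF.update_xc]
      rw [hpost b xs hd]
      cases b
      · have hc : Runs (clear (Sum.inl AReg.x : QR)) (Sum.elim (file (ent t R j) [] [] [] [] [] [] []) { S with xc := xs }.get)
            (Sum.elim bank0 { S with xc := xs }.get) (2 * (ent t R j).length + 1) :=
          (runs_clear _ _).of_eq (by rw [Sum.update_elim_inl, update_file_x]) (by simp)
        refine (Runs.pop_false' _ _ hk hup hc).of_eq ?_ ?_
        · have hSacc : S.acc = accL t R X j := by simp [hS, stE]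
          simp [hSacc]
        · omega
      · have hSacc : S.acc = accL t R X j := by simp [hS, stE]
        have g1 : Runs (move (Sum.inr acc : QR) (Sum.inl .y) (Sum.inl .s))
            (Sum.elim (file (ent t R j) [] [] [] [] [] [] []) { S with xc := xs }.get)
            (Sum.elim (file (ent t R j) (accL t R X j) [] [] [] [] [] []) { S with xc := xs, acc := [] }.get)
            (6 * (accL t R X j).length + 2) :=
          (runs_move (by decide) (by decide) (by decide) _ rfl).of_eq
            (by rw [Sum.update_elim_inr, Sum.update_elim_inl]; simp [hSacc]) (by simp [hSacc])
        have g2 : Runs (bk add)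
            (Sum.elim (file (ent t R j) (accL t R X j) [] [] [] [] [] []) { S with xc := xs, acc := [] }.get)
            (Sum.elim (file (addRes (ent t R j) (accL t R X j)) (accL t R X j) [] [] [] [] [] []) { S with xc := xs, acc := [] }.get)
            (13 * ((ent t R j).length + (accL t R X j).length) + 12) :=
          ((runs_add _ _ [] [] []).inl _).of_eq rfl le_rfl
        have g3 : Runs (clear (Sum.inl AReg.y : QR))
            (Sum.elim (file (addRes (ent t R j) (accL t R X j)) (accL t R X j) [] [] [] [] [] []) { S with xc := xs, acc := [] }.get)
            (Sum.elim (file (addRes (ent t R j) (accL t R X j)) [] [] [] [] [] [] []) { S with xc := xs, acc := [] }.get)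
            (2 * (accL t R X j).length + 1) :=
          (runs_clear _ _).of_eq (by rw [Sum.update_elim_inl]; simp) (by simp)
        have hal : (addRes (ent t R j) (accL t R X j)).length ≤ t + j + 1 := by
          have := length_addRes_le_max (ent t R j) (accL t R X j)
          have : max (ent t R j).length (accL t R X j).length ≤ t + j := max_le (hent.trans (by omega)) hacc
          omega
        have g4 : Runs (move (Sum.inl AReg.x : QR) (Sum.inr acc) (Sum.inl .s))
            (Sum.elim (file (addRes (ent t R j) (accL t R X j)) [] [] [] [] [] [] []) { S with xc := xs, acc := [] }.get)
            (Sum.elim bank0 { S with xc := xs, acc := addRes (ent t R j) (accL t R X j) }.get)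
            (6 * (addRes (ent t R j) (accL t R X j)).length + 2) :=
          (runs_move (by decide) (by decide) (by decide) _ rfl).of_eq
            (by rw [Sum.update_elim_inl, Sum.update_elim_inr]; simp) (by simp)
        refine (Runs.pop_true' _ _ hk hup ((g1.seq (g2.seq (g3.seq g4))).of_eq (by simp) ?_)).of_eq rfl le_rfl
        nlinarith [hacc, hent, hal]
  refine (h1.seq (h2.seq (h3.seq (h4.seq (h5.seq (h6.seq (h7.seq h8))))))).of_eq rfl ?_
  nlinarith [hacc, hent, hchk]

end PhaseE


section PhaseE2
open Q

/-- The entry loop of a row: `mC := mU`, then one `entryStep` per bit. [folklore] -/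
def entsLoop : Com QR :=
  copy (Sum.inr mU) (Sum.inr mC) (Sum.inl .s) (Sum.inl .t) ;; loop (Sum.inr mC) entryStep entryStep

/-- **Simulation of the entry loop.** [folklore] -/
theorem runs_entsLoop (G : QF) (t m : ℕ) (R X : List Bool) (hmU : G.mU = List.replicate m true) :
    Runs entsLoop (Sum.elim bank0 (stE G t R X 0).get) (Sum.elim bank0 (stE G t R X m).get)
      ((10 * m + 3) + ((120 * (t + 1) + 30 * m + 2) * m + 1)) := by
  have hMlen : (List.replicate m true).length = m := by simp
  have h1 : Runs (copy (Sum.inr mU : QR) (Sum.inr mC) (Sum.inl .s) (Sum.inl .t)) (Sum.elim bank0 (stE G t R X 0).get)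
      (Sum.elim bank0 { stE G t R X 0 with mC := List.replicate m true }.get) (10 * m + 3) :=
    (runs_copy (by decide) (by decide) (by decide) (by decide) (by decide) (by decide) _ rfl rfl).of_eq
      (by rw [Sum.update_elim_inr]; simp [stE, hmU]) (by simp [stE, hmU])
  let Φ : ℕ → Regs QR := fun j => Sum.elim bank0 (stE G t R X j).get
  have hΦ : ∀ j, Φ j (Sum.inr mC) = [] := fun j => by simp [Φ, stE]
  have hbody : ∀ j, 0 ≤ j → j < 0 + (List.replicate m true).length → ∀ w : List Bool,
      Runs entryStep (Function.update (Φ j) (Sum.inr mC) w) (Function.update (Φ (j + 1)) (Sum.inr mC) w)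
        (120 * (t + 1) + 30 * m) := by
    intro j _ hj w
    rw [hMlen, Nat.zero_add] at hj
    simp only [Φ]
    rw [Sum.update_elim_inr, QF.update_mC, Sum.update_elim_inr, QF.update_mC]
    exact (runs_entryStep G t R X w j).of_eq rfl (by nlinarith)
  have hloop := runs_indexLoop (c := (Sum.inr mC : QR)) Φ (120 * (t + 1) + 30 * m) hΦ (List.replicate m true) 0 hbody
  have hstart : Function.update (Φ 0) (Sum.inr mC) (List.replicate m true) =
      Sum.elim bank0 { stE G t R X 0 with mC := List.replicate m true }.get := by
    simp only [Φ]; rw [Sum.update_elim_inr, QF.update_mC]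
  rw [hstart, Nat.zero_add, hMlen] at hloop
  exact (h1.seq hloop).of_eq rfl le_rfl

/-- The residue numeral of a row: the low `t` bits of the accumulator, normalised. [folklore] -/
def resCode (t : ℕ) (R X : List Bool) (m : ℕ) : List Bool := norm ((accL t R X m).take t)

/-- Residue numerals have at most `t` bits. [folklore] -/
theorem length_resCode_le (t : ℕ) (R X : List Bool) (m : ℕ) : (resCode t R X m).length ≤ t :=
  (length_norm_le _).trans (by simp [List.length_take])

/-- **The residue step**: truncate the accumulator to `t` bits, normalise, emit at level 4 on
`o2` with its separator. [folklore] -/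
def resStep : Com QR :=
  move (Sum.inr acc) (Sum.inl .x) (Sum.inl .s) ;; copy (Sum.inr tU) (Sum.inr tC) (Sum.inl .s) (Sum.inl .t) ;;
    truncLoop tC ;; clear (Sum.inl .x) ;; pour (Sum.inl .s) (Sum.inl .x) ;; bk normalize ;;
    emitLoop .x o2 4 ;; pushSep o2 2

/-- **Simulation of the residue step.** [folklore] -/
theorem runs_resStep (G : QF) (t : ℕ) (A : List Bool) (l : ℕ) (hA : A.length ≤ l) :
    Runs resStep (Sum.elim bank0 { G with tU := List.replicate t true, tC := [], acc := A }.get)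
      (Sum.elim bank0 { G with tU := List.replicate t true, tC := [], acc := [], o2 := (repBits 4 (norm (A.take t)) ++ sep 2).reverse ++ G.o2 }.get)
      (50 * (t + l + 1)) := by
  have hTlen : (List.replicate t true).length = t := by simp
  have htk : (A.take t).length ≤ t := by simp [List.length_take]
  have hdr : (A.drop t).length ≤ l := by simp; omega
  have hnm : (norm (A.take t)).length ≤ t := (length_norm_le _).trans htk
  have h1 : Runs (move (Sum.inr acc : QR) (Sum.inl .x) (Sum.inl .s))
      (Sum.elim bank0 { G with tU := List.replicate t true, tC := [], acc := A }.get)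
      (Sum.elim (file A [] [] [] [] [] [] []) { G with tU := List.replicate t true, tC := [], acc := [] }.get) (6 * A.length + 2) :=
    (runs_move (by decide) (by decide) (by decide) _ rfl).of_eq
      (by rw [Sum.update_elim_inr, Sum.update_elim_inl]; simp) (by simp)
  have h2 : Runs (copy (Sum.inr tU : QR) (Sum.inr tC) (Sum.inl .s) (Sum.inl .t))
      (Sum.elim (file A [] [] [] [] [] [] []) { G with tU := List.replicate t true, tC := [], acc := [] }.get)
      (Sum.elim (file A [] [] [] [] [] [] []) { G with tU := List.replicate t true, tC := List.replicate t true, acc := [] }.get) (10 * t + 3) :=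
    (runs_copy (by decide) (by decide) (by decide) (by decide) (by decide) (by decide) _ rfl rfl).of_eq
      (by rw [Sum.update_elim_inr]; simp) (by simp)
  have h3 : Runs (truncLoop tC : Com QR)
      (Sum.elim (file A [] [] [] [] [] [] []) { G with tU := List.replicate t true, tC := List.replicate t true, acc := [] }.get)
      (Sum.elim (file (A.drop t) [] [] (A.take t).reverse [] [] [] []) { G with tU := List.replicate t true, tC := [], acc := [] }.get)
      (5 * t + 1) :=
    (runs_truncLoop tC (List.replicate t true) A [] [] [] [] [] [] [] _ (by simp)).of_eq
      (by rw [QF.update_tC, hTlen, List.append_nil]) (by rw [hTlen])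
  have h4 : Runs (clear (Sum.inl AReg.x : QR))
      (Sum.elim (file (A.drop t) [] [] (A.take t).reverse [] [] [] []) { G with tU := List.replicate t true, tC := [], acc := [] }.get)
      (Sum.elim (file [] [] [] (A.take t).reverse [] [] [] []) { G with tU := List.replicate t true, tC := [], acc := [] }.get)
      (2 * (A.drop t).length + 1) :=
    (runs_clear _ _).of_eq (by rw [Sum.update_elim_inl]; simp) (by simp)
  have h5 : Runs (pour (Sum.inl AReg.s : QR) (Sum.inl .x))
      (Sum.elim (file [] [] [] (A.take t).reverse [] [] [] []) { G with tU := List.replicate t true, tC := [], acc := [] }.get)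
      (Sum.elim (file (A.take t) [] [] [] [] [] [] []) { G with tU := List.replicate t true, tC := [], acc := [] }.get)
      (3 * (A.take t).length + 1) :=
    (runs_pour (by decide) _).of_eq (by rw [Sum.update_elim_inl, Sum.update_elim_inl]; simp) (by simp)
  have h6 : Runs (bk normalize)
      (Sum.elim (file (A.take t) [] [] [] [] [] [] []) { G with tU := List.replicate t true, tC := [], acc := [] }.get)
      (Sum.elim (file (norm (A.take t)) [] [] [] [] [] [] []) { G with tU := List.replicate t true, tC := [], acc := [] }.get)
      (9 * (A.take t).length + 5) :=
    ((runs_normalize _ [] [] [] [] []).inl _).of_eq rfl le_rfl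
  have h7 : Runs (emitLoop .x o2 4 : Com QR)
      (Sum.elim (file (norm (A.take t)) [] [] [] [] [] [] []) { G with tU := List.replicate t true, tC := [], acc := [] }.get)
      (Sum.elim bank0 { G with tU := List.replicate t true, tC := [], acc := [], o2 := repBits 4 (norm (A.take t)).reverse ++ G.o2 }.get)
      ((4 + 2) * (norm (A.take t)).length + 1) :=
    (runs_emitLoop .x o2 4 (norm (A.take t)) _ _ rfl).of_eq (by rw [update_file_x, QF.update_o2, QF.get_o2]) le_rfl
  have h8 := runs_pushSep_o2 2 bank0
    ({ G with tU := List.replicate t true, tC := [], acc := [], o2 := repBits 4 (norm (A.take t)).reverse ++ G.o2 } : QF)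
  refine (h1.seq (h2.seq (h3.seq (h4.seq (h5.seq (h6.seq (h7.seq h8))))))).of_eq ?_ ?_
  · simp only [List.reverse_append, reverse_repBits, List.append_assoc]
  · nlinarith [hA, htk, hdr, hnm]

/-- The emitted code of one row of the matrix (level 8 entries between the level-4/level-2
framing). [folklore] -/
def rowCode (t m : ℕ) (R : List Bool) : List Bool :=
  List.replicate (8 * m) true ++ sep 4 ++ entsOut t R m ++ sep 2

/-- The emitted residue piece of one row. [folklore] -/
def resPiece (t m : ℕ) (R X : List Bool) : List Bool := repBits 4 (resCode t R X m) ++ sep 2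

/-- **One row**: copy `x`, emit the row header, run the entries, close the row, emit the residue.
[folklore] -/
def rowStep : Com QR :=
  copy (Sum.inr xv) (Sum.inr xc) (Sum.inl .s) (Sum.inl .t) ;;
    copy (Sum.inr mU) (Sum.inl .x) (Sum.inl .s) (Sum.inl .t) ;; fillLoop .x o1 true 8 ;; pushSep o1 4 ;;
    entsLoop ;; pushSep o1 2 ;; resStep

/-- The invariant states of the row loop (matrix bits `H`, vector bits `X`). [folklore] -/
def stR (G : QF) (t m : ℕ) (H X : List Bool) (O1 O2 : ℕ → List Bool) (i : ℕ) : QF :=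
  { G with tU := List.replicate t true, mU := List.replicate m true, xv := X, hb := H.drop (i * (m * t)), xc := [], acc := [], o1 := (O1 i).reverse ++ G.o1, o2 := (O2 i).reverse ++ G.o2, nC := [], mC := [], tC := [] }

/-- The matrix output after `i` rows. [folklore] -/
def rowsOut (t m : ℕ) (H : List Bool) : ℕ → List Bool
  | 0 => []
  | i + 1 => rowsOut t m H i ++ rowCode t m (H.drop (i * (m * t)))

/-- The residue output after `i` rows. [folklore] -/
def ressOut (t m : ℕ) (H X : List Bool) : ℕ → List Bool
  | 0 => []
  | i + 1 => ressOut t m H X i ++ resPiece t m (H.drop (i * (m * t))) X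

/-- `m` chunks of `t` bits advance the row rest by `m t`. [folklore] -/
theorem drop_row (H : List Bool) (i m t : ℕ) :
    (H.drop (i * (m * t))).drop (m * t) = H.drop ((i + 1) * (m * t)) := by
  rw [List.drop_drop]; congr 1; ring

/-- **Simulation of one row.** [folklore] -/
theorem runs_rowStep (G : QF) (t m : ℕ) (H X w : List Bool) (hX : X.length ≤ m) (i : ℕ) :
    Runs rowStep (Sum.elim bank0 { stR G t m H X (rowsOut t m H) (ressOut t m H X) i with nC := w }.get)
      (Sum.elim bank0 { stR G t m H X (rowsOut t m H) (ressOut t m H X) (i + 1) with nC := w }.get)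
      ((10 * m + 3) + (10 * m + 3) + ((8 + 2) * m + 1) + (4 + 4) +
        ((10 * m + 3) + ((120 * (t + 1) + 30 * m + 2) * m + 1)) + (2 + 2) + 50 * (t + (t + m) + 1)) := by
  set R := H.drop (i * (m * t)) with hR
  set S : QF := { stR G t m H X (rowsOut t m H) (ressOut t m H X) i with nC := w } with hS
  have hMlen : (List.replicate m true).length = m := by simp
  -- xc := X
  have h1 : Runs (copy (Sum.inr xv : QR) (Sum.inr xc) (Sum.inl .s) (Sum.inl .t)) (Sum.elim bank0 S.get)
      (Sum.elim bank0 { S with xc := X }.get) (10 * X.length + 3) :=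
    (runs_copy (by decide) (by decide) (by decide) (by decide) (by decide) (by decide) _ rfl rfl).of_eq
      (by rw [Sum.update_elim_inr]; simp [hS, stR]) (by simp [hS, stR])
  -- row header
  have h2 : Runs (copy (Sum.inr mU : QR) (Sum.inl .x) (Sum.inl .s) (Sum.inl .t)) (Sum.elim bank0 { S with xc := X }.get)
      (Sum.elim (file (List.replicate m true) [] [] [] [] [] [] []) { S with xc := X }.get) (10 * m + 3) :=
    (runs_copy (by decide) (by decide) (by decide) (by decide) (by decide) (by decide) _ rfl rfl).of_eq
      (by rw [Sum.update_elim_inl]; simp [hS, stR]) (by simp [hS, stR])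
  have h3 : Runs (fillLoop .x o1 true 8 : Com QR) (Sum.elim (file (List.replicate m true) [] [] [] [] [] [] []) { S with xc := X }.get)
      (Sum.elim bank0 { S with xc := X, o1 := List.replicate (8 * m) true ++ S.o1 }.get) ((8 + 2) * m + 1) :=
    (runs_fillLoop .x o1 true 8 (List.replicate m true) _ _ rfl).of_eq
      (by rw [update_file_x, QF.update_o1, QF.get_o1, hMlen]) (by rw [hMlen])
  have h4 := runs_pushSep_o1 4 bank0 ({ S with xc := X, o1 := List.replicate (8 * m) true ++ S.o1 } : QF)
  -- entries
  have hpre : ({ ({ S with xc := X, o1 := List.replicate (8 * m) true ++ S.o1 } : QF) with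
      o1 := (sep 4).reverse ++ (List.replicate (8 * m) true ++ S.o1) } : QF) =
      stE { S with o1 := (sep 4).reverse ++ (List.replicate (8 * m) true ++ S.o1) } t R X 0 := by
    simp [hS, stR, stE, accL, entsOut, hR]
  rw [hpre] at h4
  have h5 := runs_entsLoop { S with o1 := (sep 4).reverse ++ (List.replicate (8 * m) true ++ S.o1) } t m R X
    (by simp [hS, stR])
  have h6 := runs_pushSep_o1 2 bank0 (stE { S with o1 := (sep 4).reverse ++ (List.replicate (8 * m) true ++ S.o1) } t R X m)
  -- residue
  have hA := length_accL_le t R X m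
  have hpre2 : ({ stE { S with o1 := (sep 4).reverse ++ (List.replicate (8 * m) true ++ S.o1) } t R X m with
      o1 := (sep 2).reverse ++ (stE { S with o1 := (sep 4).reverse ++ (List.replicate (8 * m) true ++ S.o1) } t R X m).o1 } : QF) =
      { S with hb := R.drop (m * t), o1 := (rowCode t m R).reverse ++ S.o1, tU := List.replicate t true, tC := [], acc := accL t R X m } := by
    have hxd : X.drop m = [] := List.drop_eq_nil_of_le hX
    simp [hS, stR, stE, rowCode, hxd, List.reverse_append, List.append_assoc]
  rw [hpre2] at h6
  have h7 := runs_resStep { S with hb := R.drop (m * t), o1 := (rowCode t m R).reverse ++ S.o1 } t (accL t R X m) (t + m) hA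
  have hpost : ({ ({ S with hb := R.drop (m * t), o1 := (rowCode t m R).reverse ++ S.o1 } : QF) with
      tU := List.replicate t true, tC := [], acc := [],
      o2 := (repBits 4 (norm ((accL t R X m).take t)) ++ sep 2).reverse ++ ({ S with hb := R.drop (m * t), o1 := (rowCode t m R).reverse ++ S.o1 } : QF).o2 } : QF) =
      { stR G t m H X (rowsOut t m H) (ressOut t m H X) (i + 1) with nC := w } := by
    have e : i * (m * t) + m * t = (i + 1) * (m * t) := by ring
    simp [hS, stR, rowsOut, ressOut, resPiece, resCode, hR, List.drop_drop, e, List.reverse_append, List.append_assoc]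
  rw [hpost] at h7
  refine (h1.seq (h2.seq (h3.seq (h4.seq (h5.seq (h6.seq h7)))))).of_eq rfl ?_
  nlinarith [hX]

/-- **Phase E**: `nC := nU`, then one `rowStep` per bit. [folklore] -/
def phaseE : Com QR :=
  copy (Sum.inr nU) (Sum.inr nC) (Sum.inl .s) (Sum.inl .t) ;; loop (Sum.inr nC) rowStep rowStep

/-- A per-row budget. [folklore] -/
def rowBudget (t m : ℕ) : ℕ :=
  (10 * m + 3) + (10 * m + 3) + ((8 + 2) * m + 1) + (4 + 4) +
    ((10 * m + 3) + ((120 * (t + 1) + 30 * m + 2) * m + 1)) + (2 + 2) + 50 * (t + (t + m) + 1)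

/-- **Simulation of phase E.** [folklore] -/
theorem runs_phaseE (G : QF) (n t m : ℕ) (H X : List Bool) (hX : X.length ≤ m) (hnU : G.nU = List.replicate n true) :
    Runs phaseE (Sum.elim bank0 (stR G t m H X (rowsOut t m H) (ressOut t m H X) 0).get)
      (Sum.elim bank0 (stR G t m H X (rowsOut t m H) (ressOut t m H X) n).get)
      ((10 * n + 3) + ((rowBudget t m + 2) * n + 1)) := by
  have hNlen : (List.replicate n true).length = n := by simp
  have h1 : Runs (copy (Sum.inr nU : QR) (Sum.inr nC) (Sum.inl .s) (Sum.inl .t))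
      (Sum.elim bank0 (stR G t m H X (rowsOut t m H) (ressOut t m H X) 0).get)
      (Sum.elim bank0 { stR G t m H X (rowsOut t m H) (ressOut t m H X) 0 with nC := List.replicate n true }.get) (10 * n + 3) :=
    (runs_copy (by decide) (by decide) (by decide) (by decide) (by decide) (by decide) _ rfl rfl).of_eq
      (by rw [Sum.update_elim_inr]; simp [stR, hnU]) (by simp [stR, hnU])
  let Φ : ℕ → Regs QR := fun i => Sum.elim bank0 (stR G t m H X (rowsOut t m H) (ressOut t m H X) i).get
  have hΦ : ∀ i, Φ i (Sum.inr nC) = [] := fun i => by simp [Φ, stR]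
  have hbody : ∀ i, 0 ≤ i → i < 0 + (List.replicate n true).length → ∀ w : List Bool,
      Runs rowStep (Function.update (Φ i) (Sum.inr nC) w) (Function.update (Φ (i + 1)) (Sum.inr nC) w) (rowBudget t m) := by
    intro i _ _ w
    simp only [Φ]
    rw [Sum.update_elim_inr, QF.update_nC, Sum.update_elim_inr, QF.update_nC]
    exact (runs_rowStep G t m H X w hX i).of_eq rfl le_rfl
  have hloop := runs_indexLoop (c := (Sum.inr nC : QR)) Φ (rowBudget t m) hΦ (List.replicate n true) 0 hbody
  have hstart : Function.update (Φ 0) (Sum.inr nC) (List.replicate n true) =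
      Sum.elim bank0 { stR G t m H X (rowsOut t m H) (ressOut t m H X) 0 with nC := List.replicate n true }.get := by
    simp only [Φ]; rw [Sum.update_elim_inr, QF.update_nC]
  rw [hstart, Nat.zero_add, hNlen] at hloop
  exact (h1.seq hloop).of_eq rfl le_rfl

end PhaseE2


/-! ### Phase F and the whole machine -/

section PhaseF
open Q

/-- **Phase F**: close both buffers with `01`, move the padding to `out`, then pour the residue
buffer and the matrix buffer on top (restoring their order). [folklore] -/
def phaseF : Com QR :=
  push (Sum.inr o1) false ;; push (Sum.inr o1) true ;; push (Sum.inr o2) false ;; push (Sum.inr o2) true ;;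
    move (Sum.inr inp) (Sum.inr out) (Sum.inl .s) ;; pour (Sum.inr o2) (Sum.inr out) ;; pour (Sum.inr o1) (Sum.inr out)

/-- **Simulation of phase F.** [folklore] -/
theorem runs_phaseF (G : QF) (E1 E2 pad : List Bool) :
    Runs phaseF (Sum.elim bank0 { G with o1 := E1.reverse, o2 := E2.reverse, inp := pad, out := [] }.get)
      (Sum.elim bank0 { G with o1 := [], o2 := [], inp := [], out := (E1 ++ [false, true]) ++ ((E2 ++ [false, true]) ++ pad) }.get)
      (4 + (6 * pad.length + 2) + (3 * (E2.length + 2) + 1) + (3 * (E1.length + 2) + 1)) := by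
  have h1a : Runs (push (Sum.inr o1 : QR) false)
      (Sum.elim bank0 { G with o1 := E1.reverse, o2 := E2.reverse, inp := pad, out := [] }.get)
      (Sum.elim bank0 { G with o1 := false :: E1.reverse, o2 := E2.reverse, inp := pad, out := [] }.get) 1 :=
    Runs.push' (by rw [Sum.update_elim_inr]; simp)
  have h1b : Runs (push (Sum.inr o1 : QR) true)
      (Sum.elim bank0 { G with o1 := false :: E1.reverse, o2 := E2.reverse, inp := pad, out := [] }.get)
      (Sum.elim bank0 { G with o1 := (E1 ++ [false, true]).reverse, o2 := E2.reverse, inp := pad, out := [] }.get) 1 :=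
    Runs.push' (by rw [Sum.update_elim_inr]; simp)
  have h1c : Runs (push (Sum.inr o2 : QR) false)
      (Sum.elim bank0 { G with o1 := (E1 ++ [false, true]).reverse, o2 := E2.reverse, inp := pad, out := [] }.get)
      (Sum.elim bank0 { G with o1 := (E1 ++ [false, true]).reverse, o2 := false :: E2.reverse, inp := pad, out := [] }.get) 1 :=
    Runs.push' (by rw [Sum.update_elim_inr]; simp)
  have h1d : Runs (push (Sum.inr o2 : QR) true)
      (Sum.elim bank0 { G with o1 := (E1 ++ [false, true]).reverse, o2 := false :: E2.reverse, inp := pad, out := [] }.get)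
      (Sum.elim bank0 { G with o1 := (E1 ++ [false, true]).reverse, o2 := (E2 ++ [false, true]).reverse, inp := pad, out := [] }.get) 1 :=
    Runs.push' (by rw [Sum.update_elim_inr]; simp)
  have h2 : Runs (move (Sum.inr inp : QR) (Sum.inr out) (Sum.inl .s))
      (Sum.elim bank0 { G with o1 := (E1 ++ [false, true]).reverse, o2 := (E2 ++ [false, true]).reverse, inp := pad, out := [] }.get)
      (Sum.elim bank0 { G with o1 := (E1 ++ [false, true]).reverse, o2 := (E2 ++ [false, true]).reverse, inp := [], out := pad }.get)
      (6 * pad.length + 2) :=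
    (runs_move (by decide) (by decide) (by decide) _ rfl).of_eq
      (by rw [Sum.update_elim_inr, Sum.update_elim_inr]; simp) (by simp)
  have h3 : Runs (pour (Sum.inr o2 : QR) (Sum.inr out))
      (Sum.elim bank0 { G with o1 := (E1 ++ [false, true]).reverse, o2 := (E2 ++ [false, true]).reverse, inp := [], out := pad }.get)
      (Sum.elim bank0 { G with o1 := (E1 ++ [false, true]).reverse, o2 := [], inp := [], out := (E2 ++ [false, true]) ++ pad }.get)
      (3 * (E2.length + 2) + 1) :=
    (runs_pour (by decide) _).of_eq (by rw [Sum.update_elim_inr, Sum.update_elim_inr]; simp) (by simp)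
  have h4 : Runs (pour (Sum.inr o1 : QR) (Sum.inr out))
      (Sum.elim bank0 { G with o1 := (E1 ++ [false, true]).reverse, o2 := [], inp := [], out := (E2 ++ [false, true]) ++ pad }.get)
      (Sum.elim bank0 { G with o1 := [], o2 := [], inp := [], out := (E1 ++ [false, true]) ++ ((E2 ++ [false, true]) ++ pad) }.get)
      (3 * (E1.length + 2) + 1) :=
    (runs_pour (by decide) _).of_eq (by rw [Sum.update_elim_inr, Sum.update_elim_inr]; simp) (by simp)
  exact (h1a.seq (h1b.seq (h1c.seq (h1d.seq (h2.seq (h3.seq h4)))))).of_eq rfl (by omega)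

/-! ### The whole machine -/

/-- **The SIS-function machine.** [folklore] -/
def sisProg : Com QR :=
  phaseA ;; phaseB1 ;; phaseB2 ;; phaseC1 ;; phaseC2 ;; phaseD ;; phaseE ;; phaseF

/-- `bitWidth n = 16 size (n + 2)`. [folklore] -/
theorem bitWidth_eq (n : ℕ) : bitWidth n = 16 * (n + 2).size := (sixteen_mul_size n).symm
/-- `width n = 2 · 16 size(n+2) · n`. [folklore] -/
theorem width_eq (n : ℕ) : width n = 2 * (16 * (n + 2).size) * n := (thirtytwo_mul_size n).symm

/-- The output string of the machine, for dimension `n`, bit width `t`, width `m`. [folklore] -/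
def outStr (n t m : ℕ) (z : List Bool) : List Bool :=
  (hdrM n t ++ rowsOut t m (z.take (n * m * t)) n ++ [false, true]) ++
    ((hdr4 n ++ ressOut t m (z.take (n * m * t)) ((z.drop (n * m * t)).take m) n ++ [false, true]) ++
      (z.drop (n * m * t)).drop m)

/-- The total step budget of the machine as a function of `k, n, t, m` and the output pieces.
[folklore] -/
def totalCost (z : List Bool) (n t m : ℕ) : ℕ :=
  budgetA.eval z.length + 2000 * (n + 3) ^ 2 + ((14 * t + 8) * n + 10 * n + 4) +
    ((10 * n + 3) + (((10 * m + 3) + ((15 * t + 6) * m + 1) + 2) * n + 1) + (3 * (n * m * t) + 1)) +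
    ((10 * m + 3) + (5 * m + 1) + (3 * m + 1)) +
    (100 * (n + 2) ^ 2 + 60 * (n + 4) + (16 * t + 12) + (32 * n + 16)) +
    ((10 * n + 3) + ((rowBudget t m + 2) * n + 1)) +
    (4 + (6 * ((z.drop (n * m * t)).drop m).length + 2) +
      (3 * ((hdr4 n ++ ressOut t m (z.take (n * m * t)) ((z.drop (n * m * t)).take m) n).length + 2) + 1) +
      (3 * ((hdrM n t ++ rowsOut t m (z.take (n * m * t)) n).length + 2) + 1))

/-- **Simulation of the whole machine** (final output and budget). [folklore] -/
theorem runs_sisProg (z : List Bool) (n t m : ℕ) (hn : dimOf z.length = n) (ht : bitWidth n = t)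
    (hm : width n = m) :
    ∃ R' : Regs QR, Runs sisProg (Regs.init (Sum.inr Q.inp) z) R' (totalCost z n t m) ∧
      R' (Sum.inr Q.out) = outStr n t m z := by
  have hcnt : cnt z.length z.length = n := by rw [cnt_self, hn]
  have hnU : (stA z z.length).nU = List.replicate n true := by simp [stA, hcnt]
  have htt : 16 * (n + 2).size = t := by rw [← bitWidth_eq, ht]
  have hmm : 2 * t * n = m := by rw [← hm, width_eq, htt]
  have hA := runs_phaseA z
  rw [init_eq]
  have hB1 := runs_phaseB1 (stA z z.length) n hnU rfl rfl rfl rfl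
  rw [htt] at hB1
  have hB2 := runs_phaseB2 { stA z z.length with tU := List.replicate t true, mb := wbin n } n t hnU rfl rfl rfl
  rw [hmm] at hB2
  have hC1 := runs_phaseC1 z { stA z z.length with tU := List.replicate t true, mb := wbin n, mU := List.replicate m true } n m t
    rfl hnU rfl rfl rfl rfl rfl rfl
  have hC2 := runs_phaseC2 (z.drop (n * m * t))
    { stA z z.length with tU := List.replicate t true, mb := wbin n, mU := List.replicate m true, inp := z.drop (n * m * t), hb := z.take (n * m * t) } m
    rfl rfl rfl rfl
  -- abbreviations for the pieces of the input
  set H := z.take (n * m * t) with hH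
  set X := (z.drop (n * m * t)).take m with hX
  set pad := (z.drop (n * m * t)).drop m with hpad
  have hXlen : X.length ≤ m := by simp [hX, List.length_take]
  set G0 : QF := { stA z z.length with mU := List.replicate m true, inp := pad, hb := H, xv := X } with hG0
  have hD := runs_phaseD G0 n t
  have eD : ({ G0 with nU := List.replicate n true, nC := [], mb := wbin n, tU := List.replicate t true } : QF) =
      { ({ stA z z.length with tU := List.replicate t true, mb := wbin n, mU := List.replicate m true, inp := z.drop (n * m * t), hb := H } : QF) with inp := pad, xv := X } := by
    rw [hG0]; simp only [stA, hcnt]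
  rw [eD] at hD
  have hE := runs_phaseE { G0 with o1 := (hdrM n t).reverse, o2 := (hdr4 n).reverse } n t m H X hXlen (by simp [hG0, hnU])
  have eE : ({ G0 with nU := List.replicate n true, nC := [], mb := [], tU := List.replicate t true, o1 := (hdrM n t).reverse ++ G0.o1, o2 := (hdr4 n).reverse ++ G0.o2 } : QF) =
      stR { G0 with o1 := (hdrM n t).reverse, o2 := (hdr4 n).reverse } t m H X (rowsOut t m H) (ressOut t m H X) 0 := by
    rw [hG0]; simp only [stR, stA, rowsOut, ressOut, hcnt, List.drop_zero, Nat.zero_mul, List.reverse_nil, List.nil_append, List.append_nil]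
  rw [eE] at hD
  have hF := runs_phaseF { G0 with tU := List.replicate t true, mU := List.replicate m true, xv := X, hb := H.drop (n * (m * t)), xc := [], acc := [], nC := [], mC := [], tC := [] }
    (hdrM n t ++ rowsOut t m H n) (hdr4 n ++ ressOut t m H X n) pad
  have eF : stR { G0 with o1 := (hdrM n t).reverse, o2 := (hdr4 n).reverse } t m H X (rowsOut t m H) (ressOut t m H X) n =
      { ({ G0 with tU := List.replicate t true, mU := List.replicate m true, xv := X, hb := H.drop (n * (m * t)), xc := [], acc := [], nC := [], mC := [], tC := [] } : QF) with
        o1 := (hdrM n t ++ rowsOut t m H n).reverse, o2 := (hdr4 n ++ ressOut t m H X n).reverse, inp := pad, out := [] } := by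
    rw [hG0]; simp only [stR, stA, List.reverse_append]
  rw [eF] at hE
  refine ⟨_, (hA.seq (hB1.seq (hB2.seq (hC1.seq (hC2.seq (hD.seq (hE.seq hF))))))).of_eq rfl (le_of_eq ?_), ?_⟩
  · simp only [totalCost, hH, hX, hpad]; ring
  · simp only [Sum.elim_inr, QF.get_out, outStr, hH, hX, hpad]

end PhaseF


/-! ### The output string is `sisFunctionWith` -/

section Strings

/-- `unaryEncodeNat n = 1^n` (twin of `Literature.Computability.Complexity.unaryEncodeNat_eq_replicate` of
`Complexity/TautCertificates.lean`, named apart; see the module docstring). [folklore] -/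
theorem unary_eq_replicate_true (n : ℕ) : unaryEncodeNat n = List.replicate n true := by
  induction n with
  | zero => rfl
  | succ n ih => rw [List.replicate_succ, ← ih]; rfl

/-- `entsOut` as a `ccat`. [folklore] -/
theorem entsOut_eq_ccat (t : ℕ) (R : List Bool) : ∀ m, entsOut t R m = ccat (fun j => repBits 8 (ent t R j) ++ sep 4) m
  | 0 => rfl
  | m + 1 => by rw [entsOut, ccat, entsOut_eq_ccat t R m]

/-- `rowsOut` as a `ccat`. [folklore] -/
theorem rowsOut_eq_ccat (t m : ℕ) (H : List Bool) : ∀ n, rowsOut t m H n = ccat (fun i => rowCode t m (H.drop (i * (m * t)))) n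
  | 0 => rfl
  | n + 1 => by rw [rowsOut, ccat, rowsOut_eq_ccat t m H n]

/-- `ressOut` as a `ccat`. [folklore] -/
theorem ressOut_eq_ccat (t m : ℕ) (H X : List Bool) : ∀ n, ressOut t m H X n = ccat (fun i => resPiece t m (H.drop (i * (m * t))) X) n
  | 0 => rfl
  | n + 1 => by rw [ressOut, ccat, ressOut_eq_ccat t m H X n]

/-- The chunks of the machine are the chunks of the specification. [folklore] -/
theorem chk_eq_chunk {n m t i j : ℕ} (z : List Bool) (hi : i < n) (hj : j < m) :
    chk t ((z.take (n * m * t)).drop (i * (m * t))) j = chunk m t z i j := by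
  rw [chk, chunk, List.drop_drop, List.drop_take, List.take_take]
  have h1 : (i * m + j + 1) * t ≤ n * m * t := by
    have : i * m + j + 1 ≤ n * m := by nlinarith
    exact Nat.mul_le_mul_right t this
  have e : i * (m * t) + j * t = (i * m + j) * t := by ring
  rw [e, min_eq_left (by rw [Nat.le_sub_iff_add_le (by nlinarith)]; nlinarith)]

/-- The entry numerals of the machine are the codes of the specification's entries. [folklore] -/
theorem ent_eq {n m t i j : ℕ} (z : List Bool) (hi : i < n) (hj : j < m) :
    ent t ((z.take (n * m * t)).drop (i * (m * t))) j = encodeNat (entryVal m t z i j) := by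
  rw [ent, chk_eq_chunk z hi hj, norm_eq_encodeNat, entryVal]

/-- Low `t` bits are the value modulo `2^t`. [folklore] -/
theorem bitsToNat_take_mod (l : List Bool) (t : ℕ) : Complexity.bitsToNat (l.take t) = Complexity.bitsToNat l % 2 ^ t := by
  have h := bitsToNat_append (l.take t) (l.drop t)
  rw [List.take_append_drop] at h
  by_cases ht : t ≤ l.length
  · have hl : (l.take t).length = t := by simp [ht]
    rw [h, hl, Nat.add_mul_mod_self_left, Nat.mod_eq_of_lt]
    have := bitsToNat_lt (l.take t); rwa [hl] at this
  · push Not at ht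
    have htake : l.take t = l := List.take_of_length_le ht.le
    rw [htake, Nat.mod_eq_of_lt]
    exact (bitsToNat_lt l).trans_le (Nat.pow_le_pow_right (by norm_num) ht.le)

/-- Value of the accumulator of row `i`. [folklore] -/
theorem bitsToNat_accL {n m t i : ℕ} (z X : List Bool) (hi : i < n) : ∀ j, j ≤ m →
    Complexity.bitsToNat (accL t ((z.take (n * m * t)).drop (i * (m * t))) X j) =
      ∑ l ∈ Finset.range j, if X.getD l false then entryVal m t z i l else 0
  | 0, _ => by simp [accL]
  | j + 1, hj => by
    rw [accL, Finset.sum_range_succ, ← bitsToNat_accL z X hi j (by omega)]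
    split_ifs with hb
    · rw [bitsToNat_addRes, ent_eq z hi (by omega), bitsToNat_encodeNat, Nat.add_comm]
    · rw [Nat.add_zero]

/-- The residue numerals of the machine are the codes of the specification's residues. [folklore] -/
theorem resCode_eq {n m t i : ℕ} (z : List Bool) (hi : i < n) :
    resCode t ((z.take (n * m * t)).drop (i * (m * t))) ((z.drop (n * m * t)).take m) m = encodeNat (residueVal n m t z i) := by
  rw [resCode, norm_eq_encodeNat, bitsToNat_take_mod, bitsToNat_accL z _ hi m le_rfl, residueVal,
    Fin.sum_univ_eq_sum_range (fun j => if xBit n m t z j then entryVal m t z i j else 0) m]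
  congr 2
  refine Finset.sum_congr rfl fun j hj => ?_
  have hjm : j < m := Finset.mem_range.1 hj
  have : ((z.drop (n * m * t)).take m).getD j false = xBit n m t z j := by
    rw [xBit, List.getD_eq_getElem?_getD, List.getD_eq_getElem?_getD, List.getElem?_take_of_lt hjm, List.getElem?_drop]
  rw [this]

/-- The doubled framed row code is the emitted row code. [folklore] -/
theorem rowCode_eq {n m t i : ℕ} (z : List Bool) (hi : i < n) :
    repBits 2 (repBits 2 (rowCodeS m t z i) ++ [false, true]) = rowCode t m ((z.take (n * m * t)).drop (i * (m * t))) := by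
  rw [repBits_frame, rowCodeS, frames_ofFn, rowCode, entsOut_eq_ccat]
  simp only [repBits_append, repBits_repBits, repBits_ccat, repBits_false_true, unary_eq_replicate_true,
    repBits_replicate, Nat.reduceMul, List.append_assoc]
  rw [show m * 2 * 4 = 8 * m by ring]
  congr 3
  refine ccat_congr fun j hj => ?_
  rw [ent_eq z hi hj]; rfl

/-- **Claim 1**: the matrix buffer is the doubled matrix code. [folklore] -/
theorem E1_eq (n t m : ℕ) (z : List Bool) (hm : width n = m) :
    hdrM n t ++ rowsOut t m (z.take (n * m * t)) n = repBits 2 (matrixCode n m t z) := by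
  have hq : repBits 4 (encodeNat (2 ^ t)) = List.replicate (4 * t) false ++ List.replicate 4 true := by
    rw [encodeNat_two_pow_eq_replicate, repBits_append, repBits_replicate, Nat.mul_comm]; rfl
  have hrows : repBits 2 (frames (List.ofFn fun i : Fin n => rowCodeS m t z i)) = rowsOut t m (z.take (n * m * t)) n := by
    rw [frames_ofFn, repBits_ccat, rowsOut_eq_ccat]
    exact ccat_congr fun i hi => rowCode_eq z hi
  rw [matrixCode]
  simp only [repBits_append, repBits_repBits, Nat.reduceMul, repBits_false_true, hrows, hq, hdrM, hdr1, hdr2, hdr3, hdr4, hm,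
    unary_eq_replicate_true, repBits_replicate, List.append_assoc]
  rw [show n * 2 * 2 = 4 * n by ring]

/-- **Claim 2**: the residue buffer is the doubled residue code. [folklore] -/
theorem E2_eq (n t m : ℕ) (z : List Bool) :
    hdr4 n ++ ressOut t m (z.take (n * m * t)) ((z.drop (n * m * t)).take m) n = repBits 2 (residueCode n m t z) := by
  have hres : repBits 2 (frames (List.ofFn fun i : Fin n => resCodeS n m t z i)) =
      ressOut t m (z.take (n * m * t)) ((z.drop (n * m * t)).take m) n := by
    rw [frames_ofFn, repBits_ccat, ressOut_eq_ccat]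
    refine ccat_congr fun i hi => ?_
    rw [repBits_frame, resPiece, resCodeS, resCode_eq z hi]
  rw [residueCode]
  simp only [repBits_append, repBits_false_true, hres, hdr4, unary_eq_replicate_true, repBits_replicate,
    List.append_assoc]
  rw [show n * 2 * 2 = 4 * n by ring]

/-- **The machine computes `sisFunctionWith`.** [folklore] -/
theorem outStr_eq (n t m : ℕ) (z : List Bool) (hm : width n = m) :
    outStr n t m z = sisFunctionWith n m t z := by
  rw [outStr, sisFunctionWith_eq, E1_eq n t m z hm, E2_eq, List.drop_drop]

end Strings


/-! ### The polynomial budget and the main theorem -/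

section Final
open Q

/-- A binary numeral is not longer than its value (twin of `Literature.Computability.MetaComplexity.length_encodeNat_le` of
`MetaComplexity/FregeProofs.lean`, named apart; see the module docstring). [folklore] -/
theorem encodeNat_length_le_self (n : ℕ) : (encodeNat n).length ≤ n := by
  rw [← norm_encodeNat, length_norm, bitsToNat_encodeNat]; exact Nat.size_le.2 Nat.lt_two_pow_self

/-- Length of the emitted entries of a row. [folklore] -/
theorem length_entsOut_le (t : ℕ) (R : List Bool) : ∀ m, (entsOut t R m).length ≤ m * (8 * t + 8)
  | 0 => by simp [entsOut]
  | m + 1 => by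
    rw [entsOut, List.length_append, List.length_append, length_repBits, length_sep, Nat.succ_mul]
    have := length_entsOut_le t R m
    have := length_ent_le t R m
    nlinarith

/-- Length of the emitted code of a row. [folklore] -/
theorem length_rowCode_le (t m : ℕ) (R : List Bool) : (rowCode t m R).length ≤ 8 * m + 12 + m * (8 * t + 8) := by
  simp only [rowCode, List.length_append, List.length_replicate, length_sep]
  have := length_entsOut_le t R m
  omega

/-- Length of the emitted rows. [folklore] -/
theorem length_rowsOut_le (t m : ℕ) (H : List Bool) : ∀ n, (rowsOut t m H n).length ≤ n * (8 * m + 12 + m * (8 * t + 8))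
  | 0 => by simp [rowsOut]
  | n + 1 => by
    rw [rowsOut, List.length_append, Nat.succ_mul]
    have := length_rowsOut_le t m H n
    have := length_rowCode_le t m (H.drop (n * (m * t)))
    omega

/-- Length of the emitted residues. [folklore] -/
theorem length_ressOut_le (t m : ℕ) (H X : List Bool) : ∀ n, (ressOut t m H X n).length ≤ n * (4 * t + 4)
  | 0 => by simp [ressOut]
  | n + 1 => by
    rw [ressOut, List.length_append, Nat.succ_mul, resPiece, List.length_append, length_repBits, length_sep]
    have := length_ressOut_le t m H X n
    have := length_resCode_le t (H.drop (n * (m * t))) X m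
    nlinarith

/-- Length of the matrix header. [folklore] -/
theorem length_hdrM_le (n t m : ℕ) (hm : width n = m) : (hdrM n t).length ≤ 4 * n + 4 * m + 4 * t + 4 * n + 24 := by
  simp only [hdrM, hdr1, hdr2, hdr3, hdr4, List.length_append, length_repBits, length_sep, List.length_replicate, hm]
  have := encodeNat_length_le_self n
  have := encodeNat_length_le_self m
  omega

/-- Everything is bounded in terms of `B = 32 (k + 2)²`. [folklore] -/
theorem params_le (k n t m : ℕ) (hn : dimOf k = n) (ht : bitWidth n = t) (hm : width n = m) :
    n ≤ k ∧ t ≤ 16 * (k + 2) ∧ m ≤ 32 * (k + 2) ^ 2 := by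
  have h1 : n ≤ k := hn ▸ (le_keyLen _).trans (keyLen_dimOf_le k)
  have h2 : t ≤ 16 * (k + 2) := by
    rw [← ht, bitWidth_eq]; have := size_add_two_le n; nlinarith
  refine ⟨h1, h2, ?_⟩
  rw [← hm, width_eq, ← bitWidth_eq, ht]; nlinarith

/-- The budget of the SIS-function machine. [folklore] -/
def sisBudget : Polynomial ℕ := budgetA + 2000 * (32 * (X + 2) ^ 2 + 4) ^ 3

/-- **The total cost is polynomial.** [folklore] -/
theorem totalCost_le (z : List Bool) (n t m : ℕ) (hn : dimOf z.length = n) (ht : bitWidth n = t)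
    (hm : width n = m) : totalCost z n t m ≤ sisBudget.eval z.length := by
  obtain ⟨hnk, htk, hmk⟩ := params_le z.length n t m hn ht hm
  set k := z.length with hk
  set B := 32 * (k + 2) ^ 2 with hB
  have hB1 : 1 ≤ B := by rw [hB]; nlinarith
  have hkB : k ≤ B := by rw [hB]; nlinarith
  have hnB : n ≤ B := hnk.trans hkB
  have htB : t ≤ B := htk.trans (by rw [hB]; nlinarith)
  have hmB : m ≤ B := hmk
  -- the output pieces
  have hpad : ((z.drop (n * m * t)).drop m).length ≤ B := by simp; omega
  have hE2 : (hdr4 n ++ ressOut t m (z.take (n * m * t)) ((z.drop (n * m * t)).take m) n).length ≤ 4 * B + 4 + B * (4 * B + 4) := by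
    rw [List.length_append]
    have h1 : (hdr4 n).length = 4 * n + 4 := by simp [hdr4]
    have h2 := length_ressOut_le t m (z.take (n * m * t)) ((z.drop (n * m * t)).take m) n
    have h3 : n * (4 * t + 4) ≤ B * (4 * B + 4) := Nat.mul_le_mul hnB (by omega)
    omega
  have hE1 : (hdrM n t ++ rowsOut t m (z.take (n * m * t)) n).length ≤ 16 * B + 24 + B * (8 * B + 12 + B * (8 * B + 8)) := by
    rw [List.length_append]
    have h1 := length_hdrM_le n t m hm
    have h2 := length_rowsOut_le t m (z.take (n * m * t)) n
    have h3 : n * (8 * m + 12 + m * (8 * t + 8)) ≤ B * (8 * B + 12 + B * (8 * B + 8)) :=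
      Nat.mul_le_mul hnB (by nlinarith [Nat.mul_le_mul hmB (show 8 * t + 8 ≤ 8 * B + 8 by omega)])
    omega
  have hrow : rowBudget t m ≤ 40 * B + 22 + (150 * B + 122) * B + 1 + 150 * B + 50 := by
    rw [rowBudget]
    have : (120 * (t + 1) + 30 * m + 2) * m ≤ (150 * B + 122) * B := Nat.mul_le_mul (by omega) hmB
    omega
  have hA : budgetA.eval k ≤ budgetA.eval k := le_rfl
  -- assemble
  have hmain : totalCost z n t m ≤ budgetA.eval k + 2000 * (B + 4) ^ 3 := by
    rw [totalCost, ← hk]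
    have p1 : 2000 * (n + 3) ^ 2 ≤ 2000 * (B + 3) ^ 2 := Nat.mul_le_mul_left _ (Nat.pow_le_pow_left (by omega) 2)
    have p2 : (14 * t + 8) * n + 10 * n + 4 ≤ (14 * B + 8) * B + 10 * B + 4 := by nlinarith
    have p3 : (10 * n + 3) + (((10 * m + 3) + ((15 * t + 6) * m + 1) + 2) * n + 1) + (3 * (n * m * t) + 1) ≤
        (10 * B + 3) + (((10 * B + 3) + ((15 * B + 6) * B + 1) + 2) * B + 1) + (3 * (B * B * B) + 1) := by
      have a1 : (15 * t + 6) * m ≤ (15 * B + 6) * B := Nat.mul_le_mul (by omega) hmB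
      have a2 : ((10 * m + 3) + ((15 * t + 6) * m + 1) + 2) * n ≤ ((10 * B + 3) + ((15 * B + 6) * B + 1) + 2) * B :=
        Nat.mul_le_mul (by omega) hnB
      have a3 : n * m * t ≤ B * B * B := Nat.mul_le_mul (Nat.mul_le_mul hnB hmB) htB
      omega
    have p4 : (10 * m + 3) + (5 * m + 1) + (3 * m + 1) ≤ 18 * B + 5 := by omega
    have p5 : 100 * (n + 2) ^ 2 + 60 * (n + 4) + (16 * t + 12) + (32 * n + 16) ≤ 100 * (B + 2) ^ 2 + 60 * (B + 4) + (16 * B + 12) + (32 * B + 16) := by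
      have : (n + 2) ^ 2 ≤ (B + 2) ^ 2 := Nat.pow_le_pow_left (by omega) 2
      omega
    have p6 : (10 * n + 3) + ((rowBudget t m + 2) * n + 1) ≤ (10 * B + 3) + ((40 * B + 22 + (150 * B + 122) * B + 1 + 150 * B + 50 + 2) * B + 1) := by
      have : (rowBudget t m + 2) * n ≤ (40 * B + 22 + (150 * B + 122) * B + 1 + 150 * B + 50 + 2) * B := Nat.mul_le_mul (by omega) hnB
      omega
    have p7 : 4 + (6 * ((z.drop (n * m * t)).drop m).length + 2) +
        (3 * ((hdr4 n ++ ressOut t m (z.take (n * m * t)) ((z.drop (n * m * t)).take m) n).length + 2) + 1) +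
        (3 * ((hdrM n t ++ rowsOut t m (z.take (n * m * t)) n).length + 2) + 1) ≤
        4 + (6 * B + 2) + (3 * (4 * B + 4 + B * (4 * B + 4) + 2) + 1) + (3 * (16 * B + 24 + B * (8 * B + 12 + B * (8 * B + 8)) + 2) + 1) := by
      omega
    have hsum : 2000 * (B + 3) ^ 2 + ((14 * B + 8) * B + 10 * B + 4) +
        ((10 * B + 3) + (((10 * B + 3) + ((15 * B + 6) * B + 1) + 2) * B + 1) + (3 * (B * B * B) + 1)) + (18 * B + 5) +
        (100 * (B + 2) ^ 2 + 60 * (B + 4) + (16 * B + 12) + (32 * B + 16)) +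
        ((10 * B + 3) + ((40 * B + 22 + (150 * B + 122) * B + 1 + 150 * B + 50 + 2) * B + 1)) +
        (4 + (6 * B + 2) + (3 * (4 * B + 4 + B * (4 * B + 4) + 2) + 1) + (3 * (16 * B + 24 + B * (8 * B + 12 + B * (8 * B + 8)) + 2) + 1)) ≤
        2000 * (B + 4) ^ 3 := by
      nlinarith [hB1]
    omega
  refine hmain.trans ?_
  simp only [sisBudget, eval_add, eval_mul, eval_pow, eval_X, eval_ofNat, ← hB]
  exact le_rfl

/-- **Discharge of the named fact `sisFunction_polyTimeComputable`** (`SISFunction.lean`): Ajtai's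
SIS function `SIS.sisFunction : {0,1}* → {0,1}*` is polynomial-time computable on Mathlib's `TM2`
model, by the explicit structured stack program `sisProg` (phases A–F: dimension by trying all
candidates, parameters, input splitting, headers, rows with entries and residues, assembly) with
its proved simulation `runs_sisProg`, the string identity `outStr_eq` and the polynomial budget
`totalCost_le`, compiled by `Com.mem_FP`. [Arora–Barak 2009, §1.3; Ajtai 1996, Thm. 1 ("easy to
compute"); Micciancio–Regev 2007, §5.1] [cite: AroraBarak2009, §1.3] -/
theorem _root_.Literature.Computability.Cryptography.sisFunction_polyTimeComputable_holds : sisFunction_polyTimeComputable := by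
  refine Com.mem_FP sisProg (Sum.inr Q.inp) (Sum.inr Q.out) sisBudget sisFunction fun z => ?_
  obtain ⟨R', hR, hout⟩ := runs_sisProg z (dimOf z.length) (bitWidth (dimOf z.length)) (width (dimOf z.length)) rfl rfl rfl
  refine ⟨R', Or.inl (hR.mono (totalCost_le z _ _ _ rfl rfl rfl)), ?_⟩
  rw [hout, outStr_eq _ _ _ _ rfl, SIS.sisFunction_eq]

end Final

end Literature.Computability.Cryptography.SISMachine

end
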